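import Summits.Ventures.CertifiedManyBodySolver.Theses.M3x2EdgeSplit
import Literature.MathematicalPhysics.QuantumLattice.HubbardNNNHoppingWindowCertificateD4
import Literature.MathematicalPhysics.QuantumLattice.HubbardTTPrimeWindowCertificateAbstractState

/-!
# Line `symreplay` — CRUX-PLAN skeleton for the crux `LowerEdge_ge_m83o100`
(item stmt-Ventures-22024, route `M3x2EdgeSplit`; team lb-sym (symmetry reduction), seat hub-lb-sym-plan-1 g0,
2026-08-28).  Twin of `Cruxes/LowerEdge_ge_m4o5/Lines/symreplay.lean` (constant `−4/5`, namespace and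
concluding decl differ).  UNREGISTERED crux workfile (registry freeze crit-3 #14 / crit-1 06:17:33Z:
one skeleton of record per item, named by the captain; this file is citeable and mergeable, and its
algebra stubs are Literature-landable without a stub match).

Crux (verbatim): `∃ lo : ℚ, -83/100 ≤ lo ∧ M3EnergyLowerRow 0 lo`.  Met BY VALUE outside Lean by
CERTIFIED #529 (MENU E₁ = −0.8295699476, margin 4.3e-4; claim node).  No summit statement is proved here;
a skeleton is a typed plan with sorried stubs, not a bound; nothing here predicts superconductivity.

## What this line adds (W4a, named in HANDOFF §U P.S. 06:05:17Z and priced by sym-ref-1 05:59:21Z)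

Every other Lines file on the two items (`wardk`, `dualreplay`, `fo_dual_rounding`,
`replayable_clique_blocks`, `clique_sparse_sos`) states its certificate over OPERATORS
`FermionOp Λ' = M_{4^|Λ'|}(ℂ)` with the window identity as a hypothesis or inside an `∃`; so none of
their value stubs can be closed from certificate BYTES except by a claim node.  This file types the
missing SYNTACTIC layer:

* Part A (computable, kernel-reducible — structural recursion only, no well-founded recursion, no
  `native_decide`, so the axiom closure stays `propext / Classical.choice / Quot.sound`): raw ladder
  letters `(site : Fin 2 → ℤ, spin : Fin 2, dagger : Bool)`, words, `ℚ`-polynomials; the CAR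
  normal-orderer `nfWord` (insertion, `c_i c†_j = δ_ij − c†_j c_i`, signs, Pauli zero); products,
  adjoints, commutators, `collect`, `isZero`; the anchored affine-`D₄` canonicaliser `canonA` (the lb-sym lever; rev 5: per-word licensed, translation ⋊ D₄-complete, sym-ref-2 l.982 / sym-ref-1 l.965
  IN THE KERNEL: every residual monomial `u` is replaced by the least normal form among its ≤ 8 ANCHORED
  images `γu + v` (bounding-box corner onto the frame corner; kept iff inside the frame, i.e. the move is
  licensed FOR THE WORD, `d4ShiftSet γ v (supp u) ⊆ Λ'`), and by `0` if two images are `±` the same word,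
  so a certificate never ships the `Y`-identification family — the soundness proof exhibits it); the cell's
  Hamiltonian / mean-energy / density / `S^±` polynomials at `(t, t', U, n) = (1, 0, 8, 7/8)`; the
  certificate record `SymCert` (Gram part in SOS-FACTOR form `Σ_k d_k • q_k† q_k`, `d_k ≥ 0` — PSD by
  construction, no PSD test; matrix-form blocks with chord-plan-1's `psdCheck` are the drop-in
  alternative), `symValue = c − Σ|a_k|`, and the Boolean checker `symCheck`.
* Kernel demos by `decide +kernel`: `c c† = 1 − c† c`, `n² = n`, `[H, N] = 0` and `[H, S⁺] = 0` on a
  bond, and a COMPLETE toy window certificate `toyCert` (3×3 frame, 17 SOS factors, `μ = −2`,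
  value `−23/4`) with `symCheck toyCert = true` — the whole pipeline replayed in the kernel.
* Part B (statements): the Ward × `D₄` window text of line `wardk` copied VERBATIM (`WardD4Identity`,
  `WardD4WindowSound`, `WardD4CertGe`; source `Cruxes/LowerEdge_ge_m4o5/Lines/wardk_defs.lean` sha16
  54aa192d958d62dc, the three blocks sha16 cbe14e8b8b4f7265 — ONE Ward text, copies are `rfl`-equal;
  local only because Lines modules are not importable on the farm, measured rc 75 `remote:stale:…:unbuilt`),
  the semantics `wordOp / polyOp`, and SIX stubs:
  S1 `stub_nfFaithful` (**PROVED rev 2**, no sorry: the CAR normal-orderer is VERIFIED — eight `insL`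
  branches against `creation_anticomm` / `creation_mul_self` / `annihilation_mul_creation` /
  `annihilation_anticommute_holds`, plus support bookkeeping) · S2 `stub_moveSound` (**PROVED rev 2**, no
  sorry: `fermionEmbed_ladderLetter` + `PolySite.d4Emb`) · S3 `stub_dictionarySound` (the four cell polynomials evaluate to `localHamiltonian Λ'`, `Γ E_Φ`,
  `n_{0σ}`, `S^±`; **rev 3: the `n_{0σ}` / `S^±` conjuncts PROVED (`dict_dens`, `dict_spinPlus`, `dict_spinMinus`),
  S3 now ASSEMBLED from the two Hamiltonian conjuncts S3a `stub_hamDictSound` (M, open) / S3b `stub_energyDictSound`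
  (**PROVED rev 5** from the tree's closed forms `hubbardTTPrimeFermionInteraction_meanEnergyObs`,
  `hubbardFermionInteraction_meanEnergyObs`, `hubbardFermionInteraction_apply_singleton/_apply_pair`)**) · S4 `stub_soundOfKernels` (L: S1 → S2 →
  S3 → `symCheck K = true → WardD4CertGe (symValue K)`) · S5 `stub_symCertData_m83o100` (XL DATA: a
  passing `SymCert` of value `≥ −83/100` exists — the word-form re-emission of a certificate of record;
  first rung: any edition `> −1.0432` beats the tree's unconditional Lean floor
  `energyDensity2D_one_eight_sevenEighths_ge`) · S6 `stub_wardWindowSound` (= wardk W3 target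
  `WardD4WindowSound`, PROVED sorry-free in `Lines/dualreplay.lean` by dual-plan-1, Literature port by
  sym-eng-3: closes by `exact` once importable).
  Composition `LowerEdge_ge_m83o100_of` concludes the crux BY NAME from S1–S6 (sorry only inside the four
  remaining chain stubs S3–S6 and the two rev-3 SUPPORT stubs S7 `stub_normalWordsIndependent` (normal words
  are linearly independent) / S8 `stub_moveEquivariant` (`nf` commutes with licensed moves up to re-collection)
  hosted OUTSIDE the chain for the orbit-pair-table checker; rev 4 file: `lean check` rc 0, sorries 7 = stubs
  S3a/S3b/S4/S5/S6 + S7/S8, S1/S2 kernel-closed; **rev 4: `collect` := sym-ref-1's fuel-structural sort-merge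
  `collect2` with its SOUNDNESS lemmas `collect_eval`/`isZero_sound`/`polyOp_eq_zero_of_isZero` (Collect2Sound.lean
  b84e4d3d70e5e0b2, verbatim — the two collector facts S4 consumes, zero remaining collector debt), replacing rev 3's
  own merge sort (the rev-1/2 association list was the measured quadratic bottleneck, memo `CHECKRATE-KN-symplan1.md`);
  and MOVE EQUIVARIANCE PROVED at operator level — `moveOp_equivariant : polyOp Λ' (nfWord (γ·w+v)) = polyOp Λ'
  (γ·(nfWord w)+v)` from S1 + the explicit S2 forms `wordOp_incl`/`wordOp_moveWord`, with the value corollary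
  `value_moveWord` for move-invariant functionals (crit-2 l.757: what the orbit-pair table consumes)**;
  **rev 5: S3b PROVED (sorries 6 = S3a/S4/S5/S6 + optional S7/S8) and Part A's canonicaliser := `canonA`
  (anchored, per-word licensed, translation ⋊ D₄-complete, sign-odd words ↦ 0; sym-ref-2 l.982 finding +
  sym-ref-1 l.965/l.971 profile folded in; `toyCanonCert` still closes, three new kernel demos)**);
  `toy_energy_ge` shows the pipeline end to end: S1–S4 + S6 ⊢ `−23/4 ≤ e₀(8, 7/8, 0)`.

Disproof used: none on record (no `Disproof.lean` on either item; `ledger negatives` has no statement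
about syntactic certificates).  Dead lines avoided: `symd3` (this seat's predecessor; a second Ward
text — withdrawn 05:59:59Z; here the Ward text is wardk's, copied, behind ONE stub S6 exactly as
`fo_dual_rounding` rev 3 does); abstract `∃ normal-orderer` checkers (existence classical ⇒ costume —
here `nfWord`/`symCheck` are concrete and run in the kernel); `native_decide` replay (adds
`Lean.ofReduceBool` — not used).
-/

namespace Summit.Ventures.CertifiedManyBodySolver.Cruxes.LowerEdge_ge_m83o100.SymReplay

open Literature.Probability.LatticeModels (Site)

/-! ## Part A — the syntactic layer (computable; kernel-reducible) -/

section Syntax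

/-- Boolean equality of sites of `ℤ²` (coordinatewise; the checker never calls the `Fintype`-based
`DecidableEq (Fin 2 → ℤ)`). -/
def siteEq (x y : Site 2) : Bool := x 0 == y 0 && x 1 == y 1

/-- Lexicographic comparison of sites. -/
def siteLt (x y : Site 2) : Bool := decide (x 0 < y 0) || (x 0 == y 0 && decide (x 1 < y 1))

/-- A raw ladder letter: site, spin (`0 = ↑`, `1 = ↓`), dagger flag (`true` = creation `c†`). -/
structure Letter where
  x : Site 2
  s : Fin 2
  dag : Bool

/-- Same orbital `(x, σ)`. -/
def Letter.modeEq (a b : Letter) : Bool := siteEq a.x b.x && a.s == b.s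

/-- Mode order: site lexicographic, then spin. -/
def Letter.modeLt (a b : Letter) : Bool := siteLt a.x b.x || (siteEq a.x b.x && decide (a.s.val < b.s.val))

/-- Equality of letters. -/
def Letter.beq (a b : Letter) : Bool := a.modeEq b && a.dag == b.dag

/-- Letter order (creators before annihilators of the same mode). -/
def Letter.blt (a b : Letter) : Bool := a.modeLt b || (a.modeEq b && a.dag && !b.dag)

/-- The adjoint letter. -/
def Letter.adj (a : Letter) : Letter := ⟨a.x, a.s, !a.dag⟩

/-- `c†_{xσ}`. -/
def cre (x : Site 2) (σ : Fin 2) : Letter := ⟨x, σ, true⟩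

/-- `c_{xσ}`. -/
def ann (x : Site 2) (σ : Fin 2) : Letter := ⟨x, σ, false⟩

/-- A word `ℓ₁ ⋯ ℓ_k` (product in list order). -/
abbrev Word := List Letter

/-- A formal `ℚ`-linear combination of words (unnormalised association list; its meaning is the sum). -/
abbrev QPoly := List (ℚ × Word)

/-- Equality of words. -/
def wordEq : Word → Word → Bool
  | [], [] => true
  | a :: u, b :: v => a.beq b && wordEq u v
  | _, _ => false

/-- Lexicographic order of words (shorter prefix first). -/
def wordLt : Word → Word → Bool
  | [], [] => false
  | [], _ :: _ => true
  | _ :: _, [] => false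
  | a :: u, b :: v => a.blt b || (a.beq b && wordLt u v)

/-- Prefix the letter `m` to every word, flipping the sign of every coefficient. -/
def consNeg (m : Letter) (p : QPoly) : QPoly := p.map fun t => (-t.1, m :: t.2)

/-- **The CAR normal-ordering kernel.**  Left-multiply the (normal-ordered) word `u` by the letter `ℓ`:
creators are inserted into the sorted creator block with a sign per transposition (`c†c† = −c†c†`,
`(c†)² = 0`), annihilators are moved right through the creators by `c_i c†_j = δ_ij − c†_j c_i` and then
inserted into the sorted annihilator block.  Structural recursion on `u`. -/
def insL (ℓ : Letter) : Word → QPoly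
  | [] => [(1, [ℓ])]
  | m :: rest =>
    if ℓ.dag then
      if m.dag then
        if ℓ.modeEq m then [] else if ℓ.modeLt m then [(1, ℓ :: m :: rest)] else consNeg m (insL ℓ rest)
      else [(1, ℓ :: m :: rest)]
    else
      if m.dag then
        (if ℓ.modeEq m then [((1 : ℚ), rest)] else []) ++ consNeg m (insL ℓ rest)
      else
        if ℓ.modeEq m then [] else if ℓ.modeLt m then [(1, ℓ :: m :: rest)] else consNeg m (insL ℓ rest)

/-- Normal form of a word: a signed sum of normal-ordered words (creators first, each block sorted). -/
def nfWord : Word → QPoly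
  | [] => [(1, [])]
  | ℓ :: w => (nfWord w).flatMap fun t => (insL ℓ t.2).map fun t' => (t.1 * t'.1, t'.2)

/-- Scalar multiple. -/
def pscale (q : ℚ) (p : QPoly) : QPoly := p.map fun t => (q * t.1, t.2)

/-- Difference `p − r` (unnormalised). -/
def psub (p r : QPoly) : QPoly := p ++ pscale (-1) r

/-- Normal form of a polynomial (termwise `nfWord`, unnormalised). -/
def nfPoly (p : QPoly) : QPoly := p.flatMap fun t => pscale t.1 (nfWord t.2)

/-- Product (concatenation of words). -/
def pmul (p r : QPoly) : QPoly := p.flatMap fun t => r.map fun t' => (t.1 * t'.1, t.2 ++ t'.2)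

/-- Adjoint word (reverse, flip daggers). -/
def adjWord (w : Word) : Word := (w.map Letter.adj).reverse

/-- Adjoint polynomial (rational coefficients are self-conjugate). -/
def padj (p : QPoly) : QPoly := p.map fun t => (t.1, adjWord t.2)

/-- Commutator `p r − r p`. -/
def comm (p r : QPoly) : QPoly := psub (pmul p r) (pmul r p)

/-! #### Collector = sym-ref-1's fuel-structural sort-merge `collect2` (rev 4; copied VERBATIM from
`pub/hub-lb/hub-lb-sym-ref-1/engine/Collect2Sound.lean` sha16 b84e4d3d70e5e0b2, checklist L3 (a), crit-1 V57;
only the final name is `collect` here so `isZero`/`identityOK` are unchanged).  Every recursion is structural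
(reduces under `decide +kernel`; measured by sym-ref-1: e2e 1 000 products 9.2 s kernel, 2×10⁵ / 10⁶ products
15.4 s / 59 s interpreted with packed letters).  Rev 3's own merge sort (splitAlt/msortFuel) is superseded because
this one comes with its SOUNDNESS lemmas (`collect_eval`, `isZero_sound` below, also verbatim). -/

/-- Merge two `wordLt`-sorted polynomials; `fuel ≥ |p| + |q|`. Structural on `fuel`. -/
def mergeF : ℕ → QPoly → QPoly → QPoly
  | 0, p, q => p ++ q
  | _ + 1, [], q => q
  | _ + 1, t :: p, [] => t :: p
  | n + 1, t :: p, t' :: q => if wordLt t'.2 t.2 then t' :: mergeF n (t :: p) q else t :: mergeF n p (t' :: q)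

/-- One bottom-up round: merge adjacent runs. Structural on the list of runs. -/
def mergePairs (n : ℕ) : List QPoly → List QPoly
  | p :: q :: rest => mergeF n p q :: mergePairs n rest
  | l => l

/-- Bottom-up merge sort driver; `rounds ≥ log₂ #runs` suffices (we pass `#runs`). Structural on `rounds`. -/
def mergeAll : ℕ → ℕ → List QPoly → QPoly
  | _, _, [] => []
  | _, _, [p] => p
  | 0, _, l => l.foldr (· ++ ·) []
  | k + 1, n, l => mergeAll k n (mergePairs n l)

/-- Sort a polynomial's terms by `wordLt` (stable). -/
def sortW (p : QPoly) : QPoly := mergeAll p.length p.length (p.map fun t => [t])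

/-- Merge ADJACENT equal words (one pass, structural). -/
def mergeAdj : QPoly → QPoly
  | [] => []
  | t :: rest =>
    match mergeAdj rest with
    | [] => [t]
    | t' :: rest' => if wordEq t.2 t'.2 then (t.1 + t'.1, t.2) :: rest' else t :: t' :: rest'

/-- Merge equal words: sort by `wordLt`, then add adjacent runs (= sym-ref-1's `collect2`). -/
def collect (p : QPoly) : QPoly := mergeAdj (sortW p)

/-- All coefficients vanish after collection. -/
def isZero (p : QPoly) : Bool := (collect p).all fun t => decide (t.1 = 0)

/-- `|q|`. -/
def qabs (q : ℚ) : ℚ := if q < 0 then -q else q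

/-! ### Sites, supports, neighbourhoods -/

/-- `x ∈ S`. -/
def memSite (x : Site 2) (S : List (Site 2)) : Bool := S.any (siteEq x)

/-- `S ⊆ T`. -/
def subSites (S T : List (Site 2)) : Bool := S.all fun x => memSite x T

/-- No repeated site. -/
def nodupSites : List (Site 2) → Bool
  | [] => true
  | x :: S => !(memSite x S) && nodupSites S

/-- Every letter of `w` sits in `S`. -/
def suppIn (w : Word) (S : List (Site 2)) : Bool := w.all fun ℓ => memSite ℓ.x S

/-- Every word of `p` is supported in `S`. -/
def psuppIn (p : QPoly) (S : List (Site 2)) : Bool := p.all fun t => suppIn t.2 S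

/-- The unit steps `e₁ = (1,0)`, `e₂ = (0,1)`. -/
def e1 : Site 2 := ![1, 0]

/-- `e₂`. -/
def e2 : Site 2 := ![0, 1]

/-- The `3 × 3` sup-metric ball `x + {−1,0,1}²` (`= thicken {x} 1`). -/
def nbhd (x : Site 2) : List (Site 2) :=
  [(-1 : ℤ), 0, 1].flatMap fun a => [(-1 : ℤ), 0, 1].map fun b => x + ![a, b]

/-- `thicken S 1` as a list. -/
def thick (S : List (Site 2)) : List (Site 2) := S.flatMap nbhd

/-! ### Affine `D₄` moves -/

/-- The linear `D₄` action on `ℤ²`, written exactly as the tree's `d4Vec` (`rot (a,b) = (−b,a)`,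
`refl (a,b) = (a,−b)`, `r i ↦ rotⁱ`, `sr i ↦ refl ∘ rotⁱ`); see `d4R_eq_d4Vec`. -/
def d4R : DihedralGroup 4 → Site 2 → Site 2
  | .r i, e => (fun v : Site 2 => (![-v 1, v 0] : Site 2))^[i.val] e
  | .sr i, e => (fun v : Site 2 => (![v 0, -v 1] : Site 2))
      ((fun v : Site 2 => (![-v 1, v 0] : Site 2))^[i.val] e)

/-- The eight elements of `D₄`. -/
def d4All : List (DihedralGroup 4) :=
  [.r 0, .r 1, .r 2, .r 3, .sr 0, .sr 1, .sr 2, .sr 3]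

/-- `x ↦ γx + v`. -/
def moveSite (γ : DihedralGroup 4) (v : Site 2) (x : Site 2) : Site 2 := d4R γ x + v

/-- Letterwise move of a word (order of letters kept). -/
def moveWord (γ : DihedralGroup 4) (v : Site 2) (w : Word) : Word :=
  w.map fun ℓ => ⟨moveSite γ v ℓ.x, ℓ.s, ℓ.dag⟩

/-- `(γ, v)` is licensed by the window: `γ·inner + v ⊆ frame` (= `d4ShiftSet γ v Λ ⊆ Λ'`). -/
def licensedMove (inner frame : List (Site 2)) (γ : DihedralGroup 4) (v : Site 2) : Bool :=
  subSites (inner.map (moveSite γ v)) frame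

/-- Order on (normal forms of) monomials used to pick the canonical representative: compare leading words,
the zero polynomial first. -/
def polyKeyLt : QPoly → QPoly → Bool
  | [], [] => false
  | [], _ :: _ => true
  | _ :: _, [] => false
  | t :: _, t' :: _ => wordLt t.2 t'.2

/-! #### The anchored affine-`D₄` canonicaliser `canonA` (rev 5; replaces rev 1–4 `canonW`).
Two referee findings folded in: (sym-ref-2 l.982, kernel-tied Python model) `canonW` licensed its moves for
the whole INNER WINDOW, so its partition of words was SOUND but strictly FINER than the translation ⋊ `D₄`
orbits (a word's reachable images depended on where it sat inside `inner`) — FIX adopted here: license the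
move FOR THE WORD (`γ·supp u + v ⊆ frame`, i.e. the window lemma with `Λ := supp u`; no thickening is needed
for a pure identification), and ANCHOR: for each of the 8 point-group elements take the unique translate
putting the image's bounding-box corner on the frame's least corner ⇒ ≤ 8 candidates, result a function of
the orbit alone (translation ⋊ `D₄`-complete on box frames); (sym-ref-1 l.965/l.971, in-Lean profile) the
rev-3 `canonW` recomputed the 72-move licence table PER TERM (0.3 s/term interpreted) — gone: nothing here
depends on a move table, sites of moved letters are flattened to literals once (`flatSite`), and the frame
corner is computed once per certificate.  Sign-odd words (an image equal to `−`itself) canonicalise to `0`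
(sound: `u − w` and `u + w` both lie in the identification span ⇒ so does `u`). -/

/-- Force a site to a literal vector (cuts closure chains in the evaluator); `flatSite x = x`. -/
def flatSite (x : Site 2) : Site 2 := ![x 0, x 1]

theorem flatSite_eq (x : Site 2) : flatSite x = x := by
  funext j; fin_cases j <;> rfl

/-- `moveWord` with flattened sites (same function, see `moveWordF_eq`). -/
def moveWordF (γ : DihedralGroup 4) (v : Site 2) (w : Word) : Word :=
  w.map fun ℓ => ⟨flatSite (moveSite γ v ℓ.x), ℓ.s, ℓ.dag⟩

theorem moveWordF_eq (γ : DihedralGroup 4) (v : Site 2) (w : Word) : moveWordF γ v w = moveWord γ v w := by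
  simp [moveWordF, moveWord, flatSite_eq]

/-- Componentwise minimum ("bounding-box corner") of a site list (junk `0` on `[]`). -/
def minCorner : List (Site 2) → Site 2
  | [] => 0
  | [x] => flatSite x
  | x :: l => let m := minCorner l; ![min (x 0) (m 0), min (x 1) (m 1)]

/-- The sites of a word, in order. -/
def wordSites (w : Word) : List (Site 2) := w.map fun ℓ => ℓ.x

/-- The anchored normal forms of `u`: for each `γ ∈ D₄`, translate `γu` so that its bounding-box corner is the
frame corner `corner`; keep it iff the image lies in the frame (the move is then licensed for `supp u`). -/
def anchoredNFs (corner : Site 2) (frame : List (Site 2)) (u : Word) : List QPoly :=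
  d4All.filterMap fun γ =>
    let v := flatSite (corner - minCorner (wordSites (moveWordF γ 0 u)))
    let w := moveWordF γ v u
    if suppIn w frame then some (nfWord w) else none

/-- `c` has the same leading word as `best` with the opposite (nonzero) coefficient. -/
def leadNegOf (best c : QPoly) : Bool :=
  match best, c with
  | t :: _, t' :: _ => wordEq t.2 t'.2 && decide (t'.1 = -t.1) && !decide (t.1 = 0)
  | _, _ => false

/-- **The anchored affine-`D₄` canonicaliser (lb-sym lever).** The `polyKeyLt`-least anchored licensed image
of `u` (identity if none fits the frame); `0` if two images of `u` are `±` the same word.  Each replacement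
differs from `u` by identification terms `Γ(γY+v) − Γ(Y)`, `Y := u`, `d4ShiftSet γ v (supp u) ⊆ Λ'`, which
vanish in the averaged window state — so the certificate ships no `Y`-family. -/
def canonA (corner : Site 2) (frame : List (Site 2)) (u : Word) : QPoly :=
  match anchoredNFs corner frame u with
  | [] => [(1, u)]
  | c :: cs =>
    let best := cs.foldl (fun b c' => if polyKeyLt c' b then c' else b) c
    if (c :: cs).any (leadNegOf best) then [] else best

/-- Canonicalise one term. -/
def canonTermA (corner : Site 2) (frame : List (Site 2)) (t : ℚ × Word) : QPoly :=
  pscale t.1 (canonA corner frame t.2)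

/-! ### The cell's operators as polynomials, `(t, t', U, n) = (1, 0, 8, 7/8)` -/

/-- `q · Σ_σ (c†_{xσ} c_{yσ} + c†_{yσ} c_{xσ})`. -/
def hop (q : ℚ) (x y : Site 2) : QPoly :=
  ([0, 1] : List (Fin 2)).flatMap fun σ => [(q, [cre x σ, ann y σ]), (q, [cre y σ, ann x σ])]

/-- `q · n_{x↑} n_{x↓} = q · c†_{x↑} c_{x↑} c†_{x↓} c_{x↓}`. -/
def onsite (q : ℚ) (x : Site 2) : QPoly := [(q, [cre x 0, ann x 0, cre x 1, ann x 1])]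

/-- `H_{Λ'} = Σ_{x ∈ Λ'} 8 n_{x↑}n_{x↓} − Σ_{x, y ∈ Λ', y − x ∈ {e₁, e₂}} Σ_σ (c†_{xσ}c_{yσ} + h.c.)`
(free boundary conditions, `t = 1`, `U = 8`, `t' = 0`). -/
def hamPoly (frame : List (Site 2)) : QPoly :=
  (frame.flatMap fun x => onsite 8 x) ++
    frame.flatMap fun x => frame.flatMap fun y =>
      if siteEq y (x + e1) || siteEq y (x + e2) then hop (-1) x y else []

/-- `E_Φ = 8 n_{0↑}n_{0↓} + ½ Σ_{y ∈ {±e₁, ±e₂}} (−1) Σ_σ (c†_{0σ}c_{yσ} + h.c.)` (mean energy per site). -/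
def energyPoly : QPoly :=
  onsite 8 0 ++ hop (-1/2) 0 e1 ++ hop (-1/2) 0 e2 ++ hop (-1/2) (-e1) 0 ++ hop (-1/2) (-e2) 0

/-- `n_{0σ}`. -/
def densPoly (σ : Fin 2) : QPoly := [(1, [cre 0 σ, ann 0 σ])]

/-- `S⁺_{Λ'} = Σ_x c†_{x↑} c_{x↓}`. -/
def spinPlusPoly (frame : List (Site 2)) : QPoly := frame.map fun x => (1, [cre x 0, ann x 1])

/-- `S⁻_{Λ'} = (S⁺)† = Σ_x c†_{x↓} c_{x↑}`. -/
def spinMinusPoly (frame : List (Site 2)) : QPoly := frame.map fun x => (1, [cre x 1, ann x 0])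

/-- Particle charge `#c† − #c`. -/
def wordCharge (w : Word) : ℤ := (w.map fun ℓ => if ℓ.dag then (1 : ℤ) else -1).sum

/-- `2S^z`-charge (as the tree's `ladderSpinCharge`). -/
def wordSpinCharge (w : Word) : ℤ :=
  (w.map fun ℓ => (if ℓ.dag then (1 : ℤ) else -1) * (if ℓ.s = 0 then 1 else -1)).sum

/-! ### The certificate record and the checker -/

/-- An explicit affine-`D₄` identification hint `z • (γu + v) − z • u` (optional; `canonA` makes them
unnecessary). -/
structure D4Move where
  z : ℚ
  u : Word
  γ : DihedralGroup 4
  v : Site 2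

/-- **A syntactic Ward × `D₄` window certificate** at the M3 cell.  `gram`: SOS factors `(d_k, q_k)`,
meaning `Σ_k d_k • q_k† q_k` with `d_k ≥ 0` (an exact `LDLᵀ`/`LᴴL` factorisation done by the PRODUCER —
certc mode gram already emits this); `eom`: words `B_k` supported in `inner` (term `H_{Λ'}B − BH_{Λ'}`);
`moves`: explicit identification hints; `charged`: `b_j • w_j` with nonzero particle or spin charge;
`wardP`/`wardM`: `X_r` (terms `S⁺X − XS⁺`, `S⁻X' − X'S⁻`); `antiH`: `d • (V† − V)`; `slack`: `a_k • w_k`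
at price `|a_k|`; `useCanon`: quotient the identity check by the anchored canonicaliser `canonA` (per-word licensed
affine-`D₄` moves; `inner` then only carries the EOM words, whose commutator with `H_{frame}` needs `thick inner ⊆ frame`). -/
structure SymCert where
  frame : List (Site 2)
  inner : List (Site 2)
  mu : ℚ
  c : ℚ
  gram : List (ℚ × QPoly)
  eom : List QPoly
  moves : List D4Move
  charged : List (ℚ × Word)
  wardP : List QPoly
  wardM : List QPoly
  antiH : List (ℚ × QPoly)
  slack : List (ℚ × Word)
  useCanon : Bool

/-- The certified value `c − Σ_k |a_k|`. -/
def symValue (K : SymCert) : ℚ := K.c - (K.slack.map fun t => qabs t.1).sum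

/-- Left-hand side `E_Φ − c·1 − μ (n_{0↑} + n_{0↓} − 7/8)`. -/
def lhsPoly (K : SymCert) : QPoly :=
  energyPoly ++ [(-K.c, [])] ++ pscale (-K.mu) (densPoly 0 ++ densPoly 1 ++ [((-7) / 8, [])])

/-- Right-hand side: Gram SOS + EOM commutators + identification hints + charged words + Ward commutators
+ anti-Hermitian parts + slack words. -/
def rhsPoly (K : SymCert) : QPoly :=
  (K.gram.flatMap fun g => pscale g.1 (pmul (padj g.2) g.2)) ++
    (K.eom.flatMap fun B => comm (hamPoly K.frame) B) ++
    (K.moves.flatMap fun mv => [(mv.z, moveWord mv.γ mv.v mv.u), (-mv.z, mv.u)]) ++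
    K.charged ++
    (K.wardP.flatMap fun X => comm (spinPlusPoly K.frame) X) ++
    (K.wardM.flatMap fun X => comm (spinMinusPoly K.frame) X) ++
    (K.antiH.flatMap fun t => pscale t.1 (psub (padj t.2) t.2)) ++
    K.slack

/-- Side conditions: frame without repeats, `0 ∈ frame`, `thicken {0} 1 ⊆ frame`, `inner ⊆ frame`,
`thicken inner 1 ⊆ frame`, `d_k ≥ 0`, supports, licences, nonzero charges. -/
def wellFormed (K : SymCert) : Bool :=
  nodupSites K.frame && memSite 0 K.frame && subSites (nbhd 0) K.frame && subSites K.inner K.frame &&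
    subSites (thick K.inner) K.frame &&
    (K.gram.all fun g => decide (0 ≤ g.1) && psuppIn g.2 K.frame) &&
    (K.eom.all fun B => psuppIn B K.inner) &&
    (K.moves.all fun mv => suppIn mv.u K.frame && suppIn (moveWordF mv.γ mv.v mv.u) K.frame) &&
    (K.charged.all fun t => suppIn t.2 K.frame && (wordCharge t.2 != 0 || wordSpinCharge t.2 != 0)) &&
    (K.wardP.all fun X => psuppIn X K.frame) && (K.wardM.all fun X => psuppIn X K.frame) &&
    (K.antiH.all fun t => psuppIn t.2 K.frame) &&
    (K.slack.all fun t => suppIn t.2 K.frame)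

/-- The identity `LHS = RHS` in `𝔄_{Λ'}`, decided syntactically: normal-order `LHS − RHS`, collect,
optionally quotient by the anchored affine-`D₄` canonicaliser (per-word licensed moves), and test for zero. -/
def identityOK (K : SymCert) : Bool :=
  let N := collect (nfPoly (psub (lhsPoly K) (rhsPoly K)))
  let corner := flatSite (minCorner K.frame)
  isZero (if K.useCanon then N.flatMap (canonTermA corner K.frame) else N)

/-- **The checker.** -/
def symCheck (K : SymCert) : Bool := wellFormed K && identityOK K

/-! ### Kernel demos (`decide +kernel`: no `Lean.ofReduceBool`) -/

/-- `c_{0↑} c†_{0↑} = 1 − c†_{0↑} c_{0↑}`. -/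
example : isZero (psub (nfWord [ann 0 0, cre 0 0]) [(1, []), (-1, [cre 0 0, ann 0 0])]) = true := by
  decide +kernel

/-- `n_{0↑}² = n_{0↑}`. -/
example : isZero (psub (nfPoly (pmul (densPoly 0) (densPoly 0))) (densPoly 0)) = true := by
  decide +kernel

/-- A two-site frame (one bond). -/
def bond2 : List (Site 2) := [0, e1]

/-- `[H_{bond}, N̂] = 0` (particle number). -/
example : isZero (nfPoly (comm (hamPoly bond2)
    (bond2.flatMap fun x => [(1, [cre x 0, ann x 0]), (1, [cre x 1, ann x 1])]))) = true := by
  decide +kernel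

/-- `[H_{bond}, S⁺] = 0` (spin rotation). -/
example : isZero (nfPoly (comm (hamPoly bond2) (spinPlusPoly bond2))) = true := by
  decide +kernel

/-- The `3 × 3` frame around the origin. -/
def frame3 : List (Site 2) := nbhd 0

/-- **Toy window certificate** (inner region empty, no Ward rows): the SOS identity
`E_Φ + 23/4 + 2 (n_{0↑} + n_{0↓} − 7/8) = 8 (c_↑c_↓)†(c_↑c_↓) + Σ_{y ∈ ±e_i, σ} ½ (c_{0σ} − c_{yσ})†(c_{0σ} − c_{yσ})
 + Σ_{y, σ} ½ c_{yσ} c†_{yσ}` — value `−23/4`. -/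
def toyCert : SymCert where
  frame := frame3
  inner := []
  mu := -2
  c := (-23) / 4
  gram := (8, [(1, [ann 0 0, ann 0 1])]) ::
    ([e1, e2, -e1, -e2].flatMap fun y => ([0, 1] : List (Fin 2)).flatMap fun σ =>
      [(1 / 2, [(1, [ann 0 σ]), (-1, [ann y σ])]), (1 / 2, [(1, [cre y σ])])])
  eom := []
  moves := []
  charged := []
  wardP := []
  wardM := []
  antiH := []
  slack := []
  useCanon := false

/-- The toy certificate PASSES the checker — the whole pipeline replayed in the kernel. -/
theorem toyCert_check : symCheck toyCert = true := by decide +kernel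

/-- Its value. -/
theorem toyCert_value : symValue toyCert = (-23) / 4 := by decide +kernel

/-- Coefficient off by `1/4`: the checker REJECTS (negative control). -/
example : symCheck { toyCert with c := (-11) / 2 } = false := by decide +kernel

/-- The `5 × 5` frame around the origin. -/
def frame5 : List (Site 2) :=
  [(-2 : ℤ), -1, 0, 1, 2].flatMap fun a => [(-2 : ℤ), -1, 0, 1, 2].map fun b => (![a, b] : Site 2)

/-- The canonicaliser at work: in the `3 × 3` frame (corner `(−1,−1)`), `n_{0↑}` is replaced by its anchored
translate `n_{(−1,−1)↑}` … -/
example : isZero (psub (canonA (![-1, -1]) frame3 [cre 0 0, ann 0 0])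
    [(1, [cre ![-1, -1] 0, ann ![-1, -1] 0])]) = true := by
  decide +kernel

/-- … translation ⋊ `D₄`-completely: the bond word `c†_{0↑} c_{e₁↑}` and its translate-reflection
`c†_{0↑} c_{−e₂↑}` get the SAME representative (sym-ref-2's l.982 split is gone) … -/
example : isZero (psub (canonA (![-1, -1]) frame3 [cre 0 0, ann e1 0])
    (canonA (![-1, -1]) frame3 [cre 0 0, ann (-e2) 0])) = true := by
  decide +kernel

/-- … and a sign-odd word (equal to minus its own reflection image) canonicalises to `0`. -/
example : canonA (![-1, -1]) frame3 [ann 0 0, ann e1 0, cre 0 0, cre e1 0] ≠ [] ∧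
    canonA (![-1, -1]) frame3 [cre 0 0, cre e1 0] = [] := by
  decide +kernel

/-- **Toy certificate using the lever** (`useCanon := true`, inner region `3 × 3`, frame `5 × 5`): the same
bound `−23/4` from FIVE SOS factors instead of seventeen — the sixteen hopping words of `E_Φ` and the four
bond SOS terms are identified by the licensed affine-`D₄` moves inside the kernel, no `Y`-family shipped:
`E_Φ + 23/4 + 2 (N₀ − 7/8) ≡ 8 (c_↑c_↓)†(c_↑c_↓) + Σ_σ [2 (c_{0σ} − c_{e₁σ})†(c_{0σ} − c_{e₁σ}) + 2 c_{e₁σ} c†_{e₁σ}]`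
modulo licensed moves. -/
def toyCanonCert : SymCert where
  frame := frame5
  inner := frame3
  mu := -2
  c := (-23) / 4
  gram := (8, [(1, [ann 0 0, ann 0 1])]) ::
    (([0, 1] : List (Fin 2)).flatMap fun σ =>
      [(2, [(1, [ann 0 σ]), (-1, [ann e1 σ])]), (2, [(1, [cre e1 σ])])])
  eom := []
  moves := []
  charged := []
  wardP := []
  wardM := []
  antiH := []
  slack := []
  useCanon := true

/-- It passes … -/
theorem toyCanonCert_check : symCheck toyCanonCert = true := by decide +kernel

/-- … and only because of the canonicaliser (negative control: the same data without the quotient fails). -/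
example : symCheck { toyCanonCert with useCanon := false } = false := by decide +kernel

end Syntax

/-! ## Part B — semantics, the Ward × `D₄` window statements (verbatim from line `wardk`), stubs, composition -/

noncomputable section

open Matrix Finset
open Literature.MathematicalPhysics.QuantumLattice
open Literature.MathematicalPhysics.QuantumLattice.HubbardWave0
open Literature.MathematicalPhysics.QuantumLattice.ThermodynamicLimit
open Literature.Probability.LatticeModels
open Literature.MathematicalPhysics.QuantumManyBody.StateRelaxation
open scoped ComplexOrder BigOperators

/-- `d4R` IS the tree's `d4Vec` (so `moveSite γ v x = d4Vec γ x + v`, the map of `PolySite.d4Emb γ v`). -/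
theorem d4R_eq_d4Vec (γ : DihedralGroup 4) (e : Site 2) : d4R γ e = d4Vec γ e := by
  cases γ <;> rfl

/-! ### Semantics of letters, words and polynomials in `𝔄_{Λ'} = FermionOp Λ'` -/

/-- The operator of a raw letter: `c^{(†)}_{xσ}` read in `Λ'` (zero if `x ∉ Λ'`; the checker's support
conditions keep every letter of a passing certificate inside its frame). -/
def letterOp (Λ' : Finset (Site 2)) (ℓ : Letter) : FermionOp Λ' :=
  if h : ℓ.x ∈ Λ' then ladderLetter (orb (PolySite.pt ℓ.x h) ℓ.s, ℓ.dag) else 0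

/-- The operator of a word: the ordered product of its letters. -/
def wordOp (Λ' : Finset (Site 2)) (w : Word) : FermionOp Λ' := (w.map (letterOp Λ')).prod

/-- The operator of a polynomial: `Σ q • wordOp w`. -/
def polyOp (Λ' : Finset (Site 2)) (p : QPoly) : FermionOp Λ' :=
  (p.map fun t => ((t.1 : ℚ) : ℂ) • wordOp Λ' t.2).sum

/-- Support of a word inside a finite region (the `Prop` twin of `suppIn`). -/
def SuppIn (w : Word) (Λ : Finset (Site 2)) : Prop := ∀ ℓ ∈ w, ℓ.x ∈ Λ

/-! ### The Ward × `D₄` window statements — VERBATIM from `Cruxes/LowerEdge_ge_m4o5/Lines/wardk_defs.lean`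
(sha16 54aa192d958d62dc; blocks `WardD4Identity` / `WardD4WindowSound` / `WardD4CertGe`, sha16 cbe14e8b8b4f7265).
One Ward text: these copies are `rfl`-equal to `WardK.*`, `DualReplay.*`, `FoDualRounding.*`; they are local
only because Lines modules are not importable on the farm (`remote:stale:…:unbuilt`, measured). -/

/-- The SU(2)-Ward × affine-`D₄` window identity in `𝔄_{Λ'}` for the `t–t'` Hubbard interaction at
target density `n`, with ONE multiplier `μ` on the total site density and the two Ward null families
`Σ_r (S⁺_{Λ'} X_r − X_r S⁺_{Λ'})`, `Σ_r (S⁻_{Λ'} X'_r − X'_r S⁻_{Λ'})` added to the null terms of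
`groundEnergy_hubbardTorusTT'_div_ge_of_window_certificate_d4`. -/
def WardD4Identity (t t' U n : ℝ) {Λ Λ' : Finset (Site 2)} (hΛ : Λ ⊆ Λ')
    (h0 : thicken ({0} : Finset (Site 2)) 1 ⊆ Λ') (hz : (0 : Site 2) ∈ Λ') (μ : ℝ)
    {m : Type} [Fintype m] [DecidableEq m] (Λm : Matrix m m ℂ) (O : m → FermionOp Λ')
    {κ : Type} (s : Finset κ) (B : κ → FermionOp Λ)
    {ι : Type} (tt : Finset ι) (γ : ι → DihedralGroup 4) (wv : ι → Site 2)
    (hsh : ∀ l, d4ShiftSet (γ l) (wv l) Λ ⊆ Λ') (Y : ι → FermionOp Λ)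
    {ρ : Type} (u : Finset ρ) (b : ρ → ℂ) (cw : ρ → List (Orb (PolySite Λ') × Bool))
    {θ : Type} (wp : Finset θ) (Xp : θ → FermionOp Λ')
    {θ' : Type} (wm : Finset θ') (Xm : θ' → FermionOp Λ')
    {δ : Type} (ah : Finset δ) (dc : δ → ℝ) (V : δ → FermionOp Λ')
    {κ'' : Type} (w : Finset κ'') (a : κ'' → ℂ) (word : κ'' → List (Orb (PolySite Λ') × Bool))
    (c : ℝ) : Prop :=
  fermionEmbed (PolySite.incl h0) ((hubbardTTPrimeFermionInteraction t t' U).meanEnergyObs 1) -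
      (c : ℂ) • (1 : FermionOp Λ') -
      ((μ : ℝ) : ℂ) • (nAt 0 hz 0 + nAt 0 hz 1 - ((n : ℝ) : ℂ) • (1 : FermionOp Λ')) =
    gramForm Λm O +
      (∑ k ∈ s, ((hubbardTTPrimeFermionInteraction t t' U).localHamiltonian Λ' * fermionEmbed (PolySite.incl hΛ) (B k) -
          fermionEmbed (PolySite.incl hΛ) (B k) * (hubbardTTPrimeFermionInteraction t t' U).localHamiltonian Λ') +
        ∑ l ∈ tt, (fermionEmbed (PolySite.incl (hsh l)) (fermionEmbed (PolySite.d4Emb (γ l) (wv l) Λ) (Y l)) -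
          fermionEmbed (PolySite.incl hΛ) (Y l)) +
        ∑ j ∈ u, b j • ladderWord (cw j) +
        ∑ r ∈ wp, ((spinPlus : FermionOp Λ') * Xp r - Xp r * (spinPlus : FermionOp Λ')) +
        ∑ r ∈ wm, ((spinMinus : FermionOp Λ') * Xm r - Xm r * (spinMinus : FermionOp Λ'))) +
      (∑ m' ∈ ah, ((dc m' : ℝ) : ℂ) • ((V m')ᴴ - V m') + ∑ k ∈ w, a k • ladderWord (word k))


/-- **W3 (target) — Ward × `D₄` window certificate ⇒ thermodynamic-limit energy density**
`c − Σₖ ‖aₖ‖ ≤ energyDensityTT' t t' U n` (`0 ≤ U`, `0 ≤ n < 2`, `thicken Λ 1 ⊆ Λ'`). With the two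
Ward families empty and `μ_↑ = μ_↓` this is `energyDensityTT'_ge_of_window_certificate_d4`. -/
def WardD4WindowSound : Prop :=
  ∀ (t t' U : ℝ), 0 ≤ U → ∀ (n : ℝ), 0 ≤ n → n < 2 →
  ∀ (Λ Λ' : Finset (Site 2)) (hΛ : Λ ⊆ Λ') (_h8 : thicken Λ 1 ⊆ Λ')
    (h0 : thicken ({0} : Finset (Site 2)) 1 ⊆ Λ') (hz : (0 : Site 2) ∈ Λ')
    (μ : ℝ)
    (m : Type) (_ : Fintype m) (_ : DecidableEq m) (Λm : Matrix m m ℂ) (_hΛm : Λm.PosSemidef)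
    (O : m → FermionOp Λ')
    (κ : Type) (s : Finset κ) (B : κ → FermionOp Λ)
    (ι : Type) (tt : Finset ι) (γ : ι → DihedralGroup 4) (wv : ι → Site 2)
    (hsh : ∀ l, d4ShiftSet (γ l) (wv l) Λ ⊆ Λ') (Y : ι → FermionOp Λ)
    (ρ : Type) (u : Finset ρ) (b : ρ → ℂ) (cw : ρ → List (Orb (PolySite Λ') × Bool))
    (_hcw : ∀ j ∈ u, ladderCharge (cw j) ≠ 0 ∨ ladderSpinCharge (cw j) ≠ 0)
    (θ : Type) (wp : Finset θ) (Xp : θ → FermionOp Λ')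
    (θ' : Type) (wm : Finset θ') (Xm : θ' → FermionOp Λ')
    (δ : Type) (ah : Finset δ) (dc : δ → ℝ) (V : δ → FermionOp Λ')
    (κ'' : Type) (w : Finset κ'') (a : κ'' → ℂ) (word : κ'' → List (Orb (PolySite Λ') × Bool))
    (c : ℝ),
    WardD4Identity t t' U n hΛ h0 hz μ Λm O s B tt γ wv hsh Y u b cw wp Xp wm Xm ah dc V w a word c →
    c - ∑ k ∈ w, ‖a k‖ ≤ energyDensityTT' t t' U n


/-- **W4 (the computational crux, parametrised by the bound `q`) — a Ward × `D₄` window certificate of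
value `≥ q` exists at `(t, t', U, n) = (1, 0, 8, 7/8)`**, all index sets finite ordinals (checker-friendly
normal form). -/
def WardD4CertGe (q : ℝ) : Prop :=
  ∃ (Λ Λ' : Finset (Site 2)) (hΛ : Λ ⊆ Λ') (_h8 : thicken Λ 1 ⊆ Λ')
    (h0 : thicken ({0} : Finset (Site 2)) 1 ⊆ Λ') (hz : (0 : Site 2) ∈ Λ')
    (μ : ℝ)
    (nm : ℕ) (Λm : Matrix (Fin nm) (Fin nm) ℂ) (_hΛm : Λm.PosSemidef) (O : Fin nm → FermionOp Λ')
    (ns : ℕ) (B : Fin ns → FermionOp Λ)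
    (nt : ℕ) (γ : Fin nt → DihedralGroup 4) (wv : Fin nt → Site 2)
    (hsh : ∀ l, d4ShiftSet (γ l) (wv l) Λ ⊆ Λ') (Y : Fin nt → FermionOp Λ)
    (nu : ℕ) (b : Fin nu → ℂ) (cw : Fin nu → List (Orb (PolySite Λ') × Bool))
    (_hcw : ∀ j ∈ (Finset.univ : Finset (Fin nu)), ladderCharge (cw j) ≠ 0 ∨ ladderSpinCharge (cw j) ≠ 0)
    (np : ℕ) (Xp : Fin np → FermionOp Λ') (nm' : ℕ) (Xm : Fin nm' → FermionOp Λ')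
    (na : ℕ) (dc : Fin na → ℝ) (V : Fin na → FermionOp Λ')
    (nw : ℕ) (a : Fin nw → ℂ) (word : Fin nw → List (Orb (PolySite Λ') × Bool))
    (c : ℝ),
    WardD4Identity 1 0 8 (7 / 8) hΛ h0 hz μ Λm O Finset.univ B Finset.univ γ wv hsh Y Finset.univ b cw
      Finset.univ Xp Finset.univ Xm Finset.univ dc V Finset.univ a word c ∧
    q ≤ c - ∑ k, ‖a k‖


/-- Ward × `D₄` window soundness + a window certificate of value `≥ q` ⇒ `q ≤ e₀(1, 0, 8, 7/8)`
(wardk's `energyDensity_ge_of_wardCert` with its first three hypotheses contracted to `WardD4WindowSound`). -/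
theorem energyDensity_ge_of_windowSound_cert (q : ℝ) (hS : WardD4WindowSound) (h4 : WardD4CertGe q) :
    q ≤ energyDensityTT' 1 0 8 (7 / 8) := by
  obtain ⟨Λ, Λ', hΛ, h8, h0, hz, μ, nm, Λm, hΛm, O, ns, B, nt, γ, wv, hsh, Y, nu, b, cw, hcw,
    np, Xp, nm', Xm, na, dc, V, nw, a, word, c, hcert, hval⟩ := h4
  have hb := hS 1 0 8 (by norm_num) (7 / 8) (by norm_num) (by norm_num) Λ Λ' hΛ h8 h0 hz μ
    (Fin nm) inferInstance inferInstance Λm hΛm O (Fin ns) Finset.univ B (Fin nt) Finset.univ γ wv hsh Y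
    (Fin nu) Finset.univ b cw hcw (Fin np) Finset.univ Xp (Fin nm') Finset.univ Xm
    (Fin na) Finset.univ dc V (Fin nw) Finset.univ a word c hcert
  linarith

/-! ### The stubs (sorry ONLY here) -/

/-- **S1 (M; PROVED below, rev 2 — CAR only).**  The normal-orderer is faithful: for a word supported in `Λ'`,
`wordOp w = polyOp (nfWord w)` in `𝔄_{Λ'}`.  Ingredients: `creation_anticomm`, `creation_mul_self`,
`annihilation_mul_creation` (`c_i c†_j = δ_ij − c†_j c_i`), `annihilation_anticommute_holds`,
`annihilation_mul_self` (FermionOperatorsProofs), and `Letter.modeEq a b = true ↔` same orbital of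
`PolySite Λ'` (`PolySite.pt` and `orb` are injective).  Literature-landable as a generic lemma over any
`[LinearOrder ι] [Fintype ι]` with a Boolean comparison realising the order. -/
def NfFaithful : Prop :=
  ∀ (Λ' : Finset (Site 2)) (w : Word), SuppIn w Λ' → wordOp Λ' w = polyOp Λ' (nfWord w)

/-- `wordOp` of the empty word. -/
@[simp] theorem wordOp_nil (Λ' : Finset (Site 2)) : wordOp Λ' [] = 1 := by
  simp [wordOp]

/-- `wordOp` of a cons. -/
@[simp] theorem wordOp_cons (Λ' : Finset (Site 2)) (ℓ : Letter) (u : Word) :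
    wordOp Λ' (ℓ :: u) = letterOp Λ' ℓ * wordOp Λ' u := by
  simp [wordOp]

/-! #### Proof of S1 (no `sorry`): list algebra of `polyOp`, three letter-level CAR identities, the
eight branches of `insL`, support bookkeeping, and the induction behind `nfWord`. -/

@[simp] theorem polyOp_nil (Λ' : Finset (Site 2)) : polyOp Λ' [] = 0 := by
  simp [polyOp]

@[simp] theorem polyOp_cons (Λ' : Finset (Site 2)) (t : ℚ × Word) (p : QPoly) :
    polyOp Λ' (t :: p) = ((t.1 : ℚ) : ℂ) • wordOp Λ' t.2 + polyOp Λ' p := by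
  simp [polyOp]

theorem polyOp_append (Λ' : Finset (Site 2)) (p q : QPoly) :
    polyOp Λ' (p ++ q) = polyOp Λ' p + polyOp Λ' q := by
  induction p with
  | nil => simp
  | cons t p ih => rw [List.cons_append, polyOp_cons, polyOp_cons, ih, add_assoc]

theorem polyOp_consNeg (Λ' : Finset (Site 2)) (m : Letter) (p : QPoly) :
    polyOp Λ' (consNeg m p) = -(letterOp Λ' m * polyOp Λ' p) := by
  induction p with
  | nil => simp [consNeg]
  | cons t p ih =>
    rw [show consNeg m (t :: p) = (-t.1, m :: t.2) :: consNeg m p from rfl, polyOp_cons, ih, polyOp_cons,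
      mul_add, mul_smul_comm, neg_add]
    rw [wordOp_cons, Rat.cast_neg, neg_smul]

theorem polyOp_map_mul (Λ' : Finset (Site 2)) (c : ℚ) (p : QPoly) :
    polyOp Λ' (p.map fun t => (c * t.1, t.2)) = ((c : ℚ) : ℂ) • polyOp Λ' p := by
  induction p with
  | nil => simp
  | cons t p ih => rw [List.map_cons, polyOp_cons, ih, polyOp_cons, smul_add, Rat.cast_mul, mul_smul]

/-- The operator of a letter inside the frame. -/
theorem letterOp_of_mem (Λ' : Finset (Site 2)) (ℓ : Letter) (h : ℓ.x ∈ Λ') :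
    letterOp Λ' ℓ = ladderLetter (orb (PolySite.pt ℓ.x h) ℓ.s, ℓ.dag) := by
  simp [letterOp, dif_pos h]

/-- `siteEq` decides equality of sites. -/
theorem siteEq_iff (x y : Site 2) : siteEq x y = true ↔ x = y := by
  constructor
  · intro h
    simp only [siteEq, Bool.and_eq_true, beq_iff_eq] at h
    funext i
    fin_cases i
    · exact h.1
    · exact h.2
  · rintro rfl
    simp [siteEq]

/-- `modeEq` decides equality of orbitals. -/
theorem modeEq_iff {Λ' : Finset (Site 2)} (a b : Letter) (ha : a.x ∈ Λ') (hb : b.x ∈ Λ') :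
    a.modeEq b = true ↔ orb (PolySite.pt a.x ha) a.s = orb (PolySite.pt b.x hb) b.s := by
  constructor
  · intro h
    simp only [Letter.modeEq, Bool.and_eq_true, beq_iff_eq, siteEq_iff] at h
    obtain ⟨hx, hs⟩ := h
    have hp : PolySite.pt a.x ha = PolySite.pt b.x hb := Subtype.ext (congrArg toLex hx)
    rw [hp, hs]
  · intro h
    have h1 : (PolySite.pt a.x ha, a.s) = (PolySite.pt b.x hb, b.s) := toLex.injective h
    have hx : a.x = b.x := by
      have h2 := congrArg (fun p : PolySite Λ' × Fin 2 => ofLex p.1.1) h1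
      simpa using h2
    have hs : a.s = b.s := congrArg Prod.snd h1
    simp [Letter.modeEq, siteEq_iff, hx, hs]

/-- `c c = 0`. -/
theorem annihilation_mul_self' {ι : Type*} [LinearOrder ι] [Fintype ι] (i : ι) :
    annihilation i * annihilation i = (0 : Matrix (Finset ι) (Finset ι) ℂ) := by
  have h : (2 : ℂ) • (annihilation i * annihilation i) = 0 := by
    rw [two_smul]; exact annihilation_anticommute_holds i i
  exact (smul_eq_zero.1 h).resolve_left two_ne_zero

/-- H1: two letters of the same kind on the same orbital multiply to zero. -/
theorem letterOp_mul_self_kind (Λ' : Finset (Site 2)) (a b : Letter) (ha : a.x ∈ Λ') (hb : b.x ∈ Λ')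
    (hk : a.dag = b.dag) (he : a.modeEq b = true) : letterOp Λ' a * letterOp Λ' b = 0 := by
  rw [letterOp_of_mem Λ' a ha, letterOp_of_mem Λ' b hb, (modeEq_iff a b ha hb).1 he, hk]
  cases b.dag
  · simp [ladderLetter, annihilation_mul_self']
  · simp [ladderLetter, creation_mul_self]

/-- H2: two letters of the same kind anticommute. -/
theorem letterOp_mul_same_kind (Λ' : Finset (Site 2)) (a b : Letter) (ha : a.x ∈ Λ') (hb : b.x ∈ Λ')
    (hk : a.dag = b.dag) : letterOp Λ' a * letterOp Λ' b = -(letterOp Λ' b * letterOp Λ' a) := by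
  rw [letterOp_of_mem Λ' a ha, letterOp_of_mem Λ' b hb, hk]
  cases b.dag
  · simp only [ladderLetter]
    exact eq_neg_of_add_eq_zero_left (annihilation_anticommute_holds _ _)
  · simp only [ladderLetter, if_true]
    exact eq_neg_of_add_eq_zero_left (creation_anticomm _ _)

/-- H3: an annihilator passing a creator, `c_a c†_b = δ_ab − c†_b c_a`. -/
theorem letterOp_ann_mul_cre (Λ' : Finset (Site 2)) (a b : Letter) (ha : a.x ∈ Λ') (hb : b.x ∈ Λ')
    (hka : a.dag = false) (hkb : b.dag = true) :
    letterOp Λ' a * letterOp Λ' b =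
      (if a.modeEq b = true then 1 else 0) - letterOp Λ' b * letterOp Λ' a := by
  rw [letterOp_of_mem Λ' a ha, letterOp_of_mem Λ' b hb, hka, hkb]
  simp only [ladderLetter, if_true, Bool.false_eq_true, if_false]
  rw [annihilation_mul_creation]
  by_cases he : a.modeEq b = true
  · rw [if_pos ((modeEq_iff a b ha hb).1 he), if_pos he]
  · rw [if_neg (fun h => he ((modeEq_iff a b ha hb).2 h)), if_neg he]

/-- Faithfulness of one insertion step. -/
theorem insL_faithful (Λ' : Finset (Site 2)) (ℓ : Letter) (hℓ : ℓ.x ∈ Λ') (u : Word) (hu : SuppIn u Λ') :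
    letterOp Λ' ℓ * wordOp Λ' u = polyOp Λ' (insL ℓ u) := by
  induction u with
  | nil => simp [insL]
  | cons m rest ih =>
    have hm : m.x ∈ Λ' := hu m List.mem_cons_self
    have hrest : SuppIn rest Λ' := fun a ha => hu a (List.mem_cons_of_mem _ ha)
    have IH := ih hrest
    rw [wordOp_cons]
    cases hd : ℓ.dag <;> cases hmd : m.dag
    · -- both annihilators
      simp only [insL, hd, hmd, Bool.false_eq_true, if_false]
      by_cases he : ℓ.modeEq m = true
      · rw [if_pos he, polyOp_nil, ← mul_assoc,
          letterOp_mul_self_kind Λ' ℓ m hℓ hm (by rw [hd, hmd]) he, zero_mul]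
      · rw [if_neg he]
        by_cases hl : ℓ.modeLt m = true
        · rw [if_pos hl]; simp
        · rw [if_neg hl, polyOp_consNeg, ← IH, ← mul_assoc,
            letterOp_mul_same_kind Λ' ℓ m hℓ hm (by rw [hd, hmd]), neg_mul, mul_assoc]
    · -- ℓ annihilator, m creator
      simp only [insL, hd, hmd, Bool.false_eq_true, if_false, if_true]
      rw [polyOp_append, polyOp_consNeg, ← IH, ← mul_assoc, letterOp_ann_mul_cre Λ' ℓ m hℓ hm hd hmd,
        sub_mul, mul_assoc, sub_eq_add_neg]
      by_cases he : ℓ.modeEq m = true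
      · rw [if_pos he, if_pos he]; simp
      · rw [if_neg he, if_neg he]; simp
    · -- ℓ creator, m annihilator
      simp only [insL, hd, hmd, Bool.false_eq_true, if_false, if_true]
      simp
    · -- both creators
      simp only [insL, hd, hmd, if_true]
      by_cases he : ℓ.modeEq m = true
      · rw [if_pos he, polyOp_nil, ← mul_assoc,
          letterOp_mul_self_kind Λ' ℓ m hℓ hm (by rw [hd, hmd]) he, zero_mul]
      · rw [if_neg he]
        by_cases hl : ℓ.modeLt m = true
        · rw [if_pos hl]; simp
        · rw [if_neg hl, polyOp_consNeg, ← IH, ← mul_assoc,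
            letterOp_mul_same_kind Λ' ℓ m hℓ hm (by rw [hd, hmd]), neg_mul, mul_assoc]

/-- Letters of the words produced by `insL ℓ u` come from `ℓ :: u`. -/
theorem insL_letters (ℓ : Letter) (u : Word) : ∀ t ∈ insL ℓ u, t.2 ⊆ ℓ :: u := by
  induction u with
  | nil =>
    intro t ht
    simp only [insL, List.mem_singleton] at ht
    subst ht
    exact List.Subset.refl _
  | cons m rest ih =>
    have hcn : ∀ t ∈ consNeg m (insL ℓ rest), t.2 ⊆ ℓ :: m :: rest := by
      intro t ht
      simp only [consNeg, List.mem_map] at ht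
      obtain ⟨t0, ht0, rfl⟩ := ht
      intro a ha
      rcases List.mem_cons.1 ha with rfl | ha
      · simp
      · have := ih t0 ht0 ha
        rcases List.mem_cons.1 this with rfl | h
        · simp
        · simp [h]
    have hfull : ∀ t : ℚ × Word, t ∈ [((1 : ℚ), ℓ :: m :: rest)] → t.2 ⊆ ℓ :: m :: rest := by
      intro t ht
      simp only [List.mem_singleton] at ht
      subst ht
      exact List.Subset.refl _
    have hrest : ∀ t : ℚ × Word, t ∈ [((1 : ℚ), rest)] → t.2 ⊆ ℓ :: m :: rest := by
      intro t ht
      simp only [List.mem_singleton] at ht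
      subst ht
      exact List.subset_cons_of_subset _ (List.subset_cons_self _ _)
    intro t ht
    cases hd : ℓ.dag <;> cases hmd : m.dag <;>
      simp only [insL, hd, hmd, Bool.false_eq_true, if_false, if_true] at ht
    · split_ifs at ht
      · simp at ht
      · exact hfull t ht
      · exact hcn t ht
    · rw [List.mem_append] at ht
      rcases ht with ht | ht
      · split_ifs at ht
        · exact hrest t ht
        · simp at ht
      · exact hcn t ht
    · exact hfull t ht
    · split_ifs at ht
      · simp at ht
      · exact hfull t ht
      · exact hcn t ht

/-- Letters of the words of `nfWord w` come from `w`. -/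
theorem nfWord_letters (w : Word) : ∀ t ∈ nfWord w, t.2 ⊆ w := by
  induction w with
  | nil => intro t ht; simp only [nfWord, List.mem_singleton] at ht; subst ht; exact List.Subset.refl _
  | cons ℓ w ih =>
    intro t ht
    simp only [nfWord, List.mem_flatMap, List.mem_map] at ht
    obtain ⟨t0, ht0, t1, ht1, rfl⟩ := ht
    intro a ha
    have h := insL_letters ℓ t0.2 t1 ht1 ha
    rcases List.mem_cons.1 h with rfl | h
    · simp
    · exact List.mem_cons_of_mem _ (ih t0 ht0 h)

/-- Multiplying a supported polynomial by a letter on the left, through `insL`. -/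
theorem letterOp_mul_polyOp (Λ' : Finset (Site 2)) (ℓ : Letter) (hℓ : ℓ.x ∈ Λ') (P : QPoly)
    (hP : ∀ t ∈ P, SuppIn t.2 Λ') :
    letterOp Λ' ℓ * polyOp Λ' P =
      polyOp Λ' (P.flatMap fun t => (insL ℓ t.2).map fun t' => (t.1 * t'.1, t'.2)) := by
  induction P with
  | nil => simp
  | cons t P ih =>
    rw [List.flatMap_cons, polyOp_append, polyOp_cons, mul_add,
      ih (fun t' ht' => hP t' (List.mem_cons_of_mem _ ht')), polyOp_map_mul, mul_smul_comm,
      insL_faithful Λ' ℓ hℓ t.2 (hP t List.mem_cons_self)]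

/-- **S1 is PROVED** (no `sorry`): the CAR normal-orderer is faithful. -/
theorem stub_nfFaithful : NfFaithful := by
  intro Λ' w hw
  induction w with
  | nil => simp [nfWord]
  | cons ℓ w ih =>
    have hℓ : ℓ.x ∈ Λ' := hw ℓ List.mem_cons_self
    have hw' : SuppIn w Λ' := fun m hm => hw m (List.mem_cons_of_mem _ hm)
    rw [wordOp_cons, ih hw', show nfWord (ℓ :: w) =
      (nfWord w).flatMap (fun t => (insL ℓ t.2).map fun t' => (t.1 * t'.1, t'.2)) from rfl]
    exact letterOp_mul_polyOp Λ' ℓ hℓ (nfWord w)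
      (fun t ht a ha => hw' a (nfWord_letters w t ht ha))

/-- **S2 (M; PROVED below, rev 2 — relabelling).**  A licensed affine-`D₄` move of a word supported in the inner region is a
window identification term: both `u` and `γu + v` are embeddings of ONE `Y ∈ 𝔄_Λ` (namely the word read in
`Λ`), the second through `PolySite.d4Emb γ v Λ` — exactly the shape `Γ_{hsh}(Γ_{γ,v} Y)`, `Γ_{hΛ} Y` of the
family `tt` in `WardD4Identity`.  Ingredients: `fermionEmbed_ladderWord`, `Orb.embMap`,
`PolySite.ofLex_coe_d4Emb`, `d4R_eq_d4Vec`, `List.prod` of embeddings (`fermionEmbed` is multiplicative). -/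
def MoveSound : Prop :=
  ∀ (Λ Λ' : Finset (Site 2)) (hΛ : Λ ⊆ Λ') (γ : DihedralGroup 4) (v : Site 2)
    (hsh : d4ShiftSet γ v Λ ⊆ Λ') (u : Word), SuppIn u Λ →
    ∃ Y : FermionOp Λ, wordOp Λ' u = fermionEmbed (PolySite.incl hΛ) Y ∧
      wordOp Λ' (moveWord γ v u) =
        fermionEmbed (PolySite.incl hsh) (fermionEmbed (PolySite.d4Emb γ v Λ) Y)

/-! #### Proof of S2 (no `sorry`). -/

/-- A licensed move keeps letters inside the frame. -/
theorem moveSite_mem {Λ Λ' : Finset (Site 2)} {γ : DihedralGroup 4} {v : Site 2}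
    (hsh : d4ShiftSet γ v Λ ⊆ Λ') {x : Site 2} (hx : x ∈ Λ) : moveSite γ v x ∈ Λ' := by
  have h := d4Vec_add_mem_d4ShiftSet γ v hx
  rw [← d4R_eq_d4Vec] at h
  exact hsh h

/-- The moved site as an ordered site of `Λ'` is the image of `pt x` under `incl hsh ∘ d4Emb γ v Λ`. -/
theorem pt_moveSite {Λ Λ' : Finset (Site 2)} {γ : DihedralGroup 4} {v : Site 2}
    (hsh : d4ShiftSet γ v Λ ⊆ Λ') {x : Site 2} (hx : x ∈ Λ) :
    PolySite.pt (moveSite γ v x) (moveSite_mem hsh hx) =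
      (PolySite.incl hsh) (PolySite.d4Emb γ v Λ (PolySite.pt x hx)) := by
  apply Subtype.ext
  show toLex (moveSite γ v x) = toLex (d4Vec γ (ofLex (toLex x)) + v)
  rw [moveSite, d4R_eq_d4Vec]
  rfl

/-- **S2 is PROVED** (no `sorry`): licensed affine-`D₄` moves of words are window identification terms. -/
theorem stub_moveSound : MoveSound := by
  intro Λ Λ' hΛ γ v hsh u hu
  induction u with
  | nil =>
    exact ⟨1, by simp, by simp [moveWord]⟩
  | cons ℓ u ih =>
    obtain ⟨Y, hY, hY'⟩ := ih (fun m hm => hu m (List.mem_cons_of_mem _ hm))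
    have hℓ : ℓ.x ∈ Λ := hu ℓ (List.mem_cons_self)
    refine ⟨ladderLetter (orb (PolySite.pt ℓ.x hℓ) ℓ.s, ℓ.dag) * Y, ?_, ?_⟩
    · rw [wordOp_cons, map_mul, fermionEmbed_ladderLetter, hY]
      congr 1
      simp only [letterOp, dif_pos (hΛ hℓ)]
      rfl
    · have hm : moveSite γ v ℓ.x ∈ Λ' := moveSite_mem hsh hℓ
      show wordOp Λ' (⟨moveSite γ v ℓ.x, ℓ.s, ℓ.dag⟩ :: moveWord γ v u) = _
      rw [wordOp_cons, map_mul, map_mul, fermionEmbed_ladderLetter, fermionEmbed_ladderLetter, hY']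
      congr 1
      simp only [letterOp, dif_pos hm]
      rw [pt_moveSite hsh hℓ]
      rfl

/-! #### Collector SOUNDNESS (sym-ref-1 `Collect2Sound.lean` b84e4d3d70e5e0b2 §Sound, VERBATIM modulo the names
`collect2 ↦ collect`, `isZero2 ↦ isZero`; `evalP (wordOp Λ') = polyOp Λ'` definitionally).  These are exactly the
two collector facts S4 `stub_soundOfKernels` consumes: `collect_eval`, `isZero_sound`. -/

section CollectSound

variable {M : Type*} [AddCommGroup M] [Module ℂ M]

/-- Meaning of a formal `ℚ`-polynomial under a word semantics `f` (`polyOp Λ' = evalP (wordOp Λ')`). -/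
def evalP (f : Word → M) (p : QPoly) : M := (p.map fun t => ((t.1 : ℚ) : ℂ) • f t.2).sum

theorem polyOp_eq_evalP (Λ' : Finset (Site 2)) (p : QPoly) : polyOp Λ' p = evalP (wordOp Λ') p := rfl

omit [Module ℂ M] in
theorem Letter.beq_iff (a b : Letter) : a.beq b = true ↔ a = b := by
  cases a; cases b
  simp [Letter.beq, Letter.modeEq, siteEq_iff, Bool.and_eq_true]
  tauto

omit [Module ℂ M] in
theorem wordEq_iff : ∀ (u v : Word), wordEq u v = true ↔ u = v
  | [], [] => by simp [wordEq]
  | [], _ :: _ => by simp [wordEq]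
  | _ :: _, [] => by simp [wordEq]
  | a :: u, b :: v => by simp [wordEq, Bool.and_eq_true, Letter.beq_iff, wordEq_iff u v]

@[simp] theorem evalP_nil (f : Word → M) : evalP f [] = 0 := by simp [evalP]

@[simp] theorem evalP_cons (f : Word → M) (t : ℚ × Word) (p : QPoly) :
    evalP f (t :: p) = ((t.1 : ℚ) : ℂ) • f t.2 + evalP f p := by simp [evalP]

theorem evalP_append (f : Word → M) (p q : QPoly) : evalP f (p ++ q) = evalP f p + evalP f q := by
  simp [evalP, List.map_append, List.sum_append]

theorem evalP_perm (f : Word → M) {p q : QPoly} (h : p.Perm q) : evalP f p = evalP f q := by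
  unfold evalP; exact (h.map _).sum_eq

omit [Module ℂ M] in
/-- `mergeF` only interleaves: a permutation of `p ++ q` at every fuel (no fuel-adequacy debt). -/
theorem mergeF_perm : ∀ (n : ℕ) (p q : QPoly), (mergeF n p q).Perm (p ++ q)
  | 0, p, q => by simp [mergeF]
  | _ + 1, [], q => by simp [mergeF]
  | _ + 1, t :: p, [] => by simp [mergeF]
  | n + 1, t :: p, t' :: q => by
    simp only [mergeF]
    split
    · exact ((mergeF_perm n (t :: p) q).cons t').trans List.perm_middle.symm
    · exact ((mergeF_perm n p (t' :: q)).cons t).trans (by simp)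

omit [Module ℂ M] in
theorem mergePairs_flatten : ∀ (n : ℕ) (l : List QPoly), (mergePairs n l).flatten.Perm l.flatten
  | n, [] => by simp [mergePairs]
  | n, [p] => by simp [mergePairs]
  | n, p :: q :: rest => by
    simp only [mergePairs, List.flatten_cons, ← List.append_assoc]
    exact (mergeF_perm n p q).append (mergePairs_flatten n rest)

omit [Module ℂ M] in
theorem foldr_append_nil_eq_flatten : ∀ (l : List QPoly), l.foldr (· ++ ·) [] = l.flatten
  | [] => rfl
  | p :: l => by simp [List.foldr, foldr_append_nil_eq_flatten l]

omit [Module ℂ M] in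
theorem mergeAll_perm : ∀ (k n : ℕ) (l : List QPoly), (mergeAll k n l).Perm l.flatten := by
  intro k
  induction k with
  | zero =>
    intro n l
    match l with
    | [] => simp [mergeAll]
    | [p] => simp [mergeAll]
    | p :: q :: rest =>
      rw [mergeAll.eq_def]
      simp [foldr_append_nil_eq_flatten]
  | succ k ih =>
    intro n l
    match l with
    | [] => simp [mergeAll]
    | [p] => simp [mergeAll]
    | p :: q :: rest =>
      rw [mergeAll.eq_def]
      simp only
      exact (ih n _).trans (mergePairs_flatten n _)

omit [Module ℂ M] in
theorem sortW_perm (p : QPoly) : (sortW p).Perm p := by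
  unfold sortW
  refine (mergeAll_perm _ _ _).trans ?_
  have : (p.map fun t => [t]).flatten = p := by
    induction p with
    | nil => rfl
    | cons t p ih => simp [ih]
  rw [this]

/-- Merging adjacent equal words does not change the meaning. -/
theorem mergeAdj_eval (f : Word → M) : ∀ (p : QPoly), evalP f (mergeAdj p) = evalP f p
  | [] => by simp [mergeAdj]
  | t :: rest => by
    have ih := mergeAdj_eval f rest
    rw [mergeAdj]
    split
    · next h => rw [h] at ih; simp [← ih]
    · next t' rest' h =>
      rw [h] at ih
      split
      · next hw =>
        have hw' : t.2 = t'.2 := (wordEq_iff _ _).1 hw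
        rw [evalP_cons, evalP_cons, ← ih, evalP_cons, hw', ← add_assoc, ← add_smul]
        push_cast; rfl
      · simp only [evalP_cons]
        rw [← ih, evalP_cons]

/-- **Soundness of the collector**: `collect` preserves meaning under every word semantics. -/
theorem collect_eval (f : Word → M) (p : QPoly) : evalP f (collect p) = evalP f p := by
  rw [collect, mergeAdj_eval, evalP_perm f (sortW_perm p)]

omit [Module ℂ M] in
theorem evalP_eq_zero_of_all {N : Type*} [AddCommGroup N] [Module ℂ N] (f : Word → N) :
    ∀ (p : QPoly), (p.all fun t => decide (t.1 = 0)) = true → evalP f p = 0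
  | [], _ => by simp
  | t :: p, h => by
    simp only [List.all_cons, Bool.and_eq_true, decide_eq_true_eq] at h
    rw [evalP_cons, h.1, evalP_eq_zero_of_all f p h.2]; simp

/-- **Soundness of `isZero`**: all collected coefficients `0` ⇒ meaning `0` under every word semantics. -/
theorem isZero_sound (f : Word → M) (p : QPoly) (h : isZero p = true) : evalP f p = 0 := by
  rw [← collect_eval f p]
  exact evalP_eq_zero_of_all f _ h

/-- The form S4 uses: `isZero p ⇒ polyOp Λ' p = 0`. -/
theorem polyOp_eq_zero_of_isZero (Λ' : Finset (Site 2)) (p : QPoly) (h : isZero p = true) : polyOp Λ' p = 0 :=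
  isZero_sound (wordOp Λ') p h

end CollectSound

/-- Move every word of a polynomial by the affine `D₄` move `(γ, v)`. -/
def movePolyW (γ : DihedralGroup 4) (v : Site 2) (p : QPoly) : QPoly := p.map fun t => (t.1, moveWord γ v t.2)

/-! #### MOVE EQUIVARIANCE of normal ordering, PROVED (rev 4; crit-2 l.743 (ii) / l.757: the semantic statement the
orbit-pair table consumes — no linear-independence lemma needed).  Explicit forms of S2 first. -/

/-- Isotony, explicit: a word supported in `Λ ⊆ Λ'` read in `Λ'` is the embedded word read in `Λ`. -/
theorem wordOp_incl {Λ Λ' : Finset (Site 2)} (hΛ : Λ ⊆ Λ') (u : Word) (hu : SuppIn u Λ) :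
    wordOp Λ' u = fermionEmbed (PolySite.incl hΛ) (wordOp Λ u) := by
  induction u with
  | nil => simp
  | cons ℓ u ih =>
    have hℓ : ℓ.x ∈ Λ := hu ℓ List.mem_cons_self
    rw [wordOp_cons, wordOp_cons, map_mul, ← ih (fun m hm => hu m (List.mem_cons_of_mem _ hm))]
    congr 1
    simp only [letterOp, dif_pos hℓ, dif_pos (hΛ hℓ)]
    rw [fermionEmbed_ladderLetter]
    rfl

/-- Moves, explicit: `wordOp Λ' (γ·u + v) = Γ_{hsh} (Γ_{γ,v} (wordOp Λ u))`. -/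
theorem wordOp_moveWord {Λ Λ' : Finset (Site 2)} {γ : DihedralGroup 4} {v : Site 2}
    (hsh : d4ShiftSet γ v Λ ⊆ Λ') (u : Word) (hu : SuppIn u Λ) :
    wordOp Λ' (moveWord γ v u) =
      fermionEmbed (PolySite.incl hsh) (fermionEmbed (PolySite.d4Emb γ v Λ) (wordOp Λ u)) := by
  induction u with
  | nil => simp [moveWord]
  | cons ℓ u ih =>
    have hℓ : ℓ.x ∈ Λ := hu ℓ List.mem_cons_self
    have hm : moveSite γ v ℓ.x ∈ Λ' := moveSite_mem hsh hℓ
    have ih' := ih (fun m hm => hu m (List.mem_cons_of_mem _ hm))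
    show wordOp Λ' (⟨moveSite γ v ℓ.x, ℓ.s, ℓ.dag⟩ :: moveWord γ v u) = _
    rw [wordOp_cons, wordOp_cons, map_mul, map_mul, ← ih']
    congr 1
    simp only [letterOp, dif_pos hm, dif_pos hℓ]
    rw [fermionEmbed_ladderLetter, fermionEmbed_ladderLetter, pt_moveSite hsh hℓ]
    rfl

/-- The letters of a moved word. -/
theorem suppIn_moveWord {Λ Λ' : Finset (Site 2)} {γ : DihedralGroup 4} {v : Site 2}
    (hsh : d4ShiftSet γ v Λ ⊆ Λ') (u : Word) (hu : SuppIn u Λ) : SuppIn (moveWord γ v u) Λ' := by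
  intro ℓ hℓ
  rw [moveWord, List.mem_map] at hℓ
  obtain ⟨m, hm, rfl⟩ := hℓ
  exact moveSite_mem hsh (hu m hm)

/-- Moving a polynomial termwise moves its operator. -/
theorem polyOp_movePolyW {Λ Λ' : Finset (Site 2)} {γ : DihedralGroup 4} {v : Site 2}
    (hsh : d4ShiftSet γ v Λ ⊆ Λ') (p : QPoly) (hp : ∀ t ∈ p, SuppIn t.2 Λ) :
    polyOp Λ' (movePolyW γ v p) =
      fermionEmbed (PolySite.incl hsh) (fermionEmbed (PolySite.d4Emb γ v Λ) (polyOp Λ p)) := by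
  induction p with
  | nil => simp [movePolyW]
  | cons t p ih =>
    have ih' := ih (fun s hs => hp s (List.mem_cons_of_mem _ hs))
    show polyOp Λ' ((t.1, moveWord γ v t.2) :: movePolyW γ v p) = _
    rw [polyOp_cons, polyOp_cons, map_add, map_add, map_smul, map_smul, ih',
      wordOp_moveWord hsh t.2 (hp t List.mem_cons_self)]

/-- **MOVE EQUIVARIANCE (operator level, PROVED from S1 + S2's explicit form):** normal-ordering the moved word and
moving the normal-ordered word have the SAME operator in the frame algebra.  Hence the same VALUE under every
linear functional — invariant or not; invariance of the averaged window state enters only when a moved pair is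
replaced by its canonical representative (`value_moveWord` below). -/
theorem moveOp_equivariant {Λ Λ' : Finset (Site 2)} {γ : DihedralGroup 4} {v : Site 2}
    (hsh : d4ShiftSet γ v Λ ⊆ Λ') (w : Word) (hw : SuppIn w Λ) :
    polyOp Λ' (nfWord (moveWord γ v w)) = polyOp Λ' (movePolyW γ v (nfWord w)) := by
  rw [← stub_nfFaithful Λ' _ (suppIn_moveWord hsh w hw), wordOp_moveWord hsh w hw,
    polyOp_movePolyW hsh (nfWord w) (fun t ht ℓ hℓ => hw ℓ (nfWord_letters w t ht hℓ)),
    ← stub_nfFaithful Λ w hw]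

/-- **VALUE form for the orbit-pair table (crit-2 l.757 (1)–(4)):** under any linear functional `φ` on the frame
algebra that is invariant under the licensed move (`φ ∘ Γ_{hsh} ∘ Γ_{γ,v} = φ ∘ Γ_{hΛ}` on `𝔄_Λ` — the D₄/shift
average the window soundness theorem builds), a moved word has the value of the unmoved one, and its normal
form may be taken before or after the move. -/
theorem value_moveWord {Λ Λ' : Finset (Site 2)} (hΛ : Λ ⊆ Λ') {γ : DihedralGroup 4} {v : Site 2}
    (hsh : d4ShiftSet γ v Λ ⊆ Λ') (φ : FermionOp Λ' →ₗ[ℂ] ℂ)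
    (hφ : ∀ Y : FermionOp Λ,
      φ (fermionEmbed (PolySite.incl hsh) (fermionEmbed (PolySite.d4Emb γ v Λ) Y)) = φ (fermionEmbed (PolySite.incl hΛ) Y))
    (w : Word) (hw : SuppIn w Λ) :
    φ (wordOp Λ' (moveWord γ v w)) = φ (wordOp Λ' w) ∧
      φ (polyOp Λ' (nfWord (moveWord γ v w))) = φ (polyOp Λ' (movePolyW γ v (nfWord w))) := by
  refine ⟨?_, by rw [moveOp_equivariant hsh w hw]⟩
  rw [wordOp_moveWord hsh w hw, hφ, ← wordOp_incl hΛ w hw]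

/-- **S3 (M; TRUE iff Part A transcribes the cell correctly — the kernel demos `[H,N] = [H,S⁺] = 0` and the
toy certificates are partial evidence).**  The dictionary: on a repeat-free frame list, `hamPoly` evaluates to
the tree's local Hamiltonian of `hubbardTTPrimeFermionInteraction 1 0 8`, `energyPoly` to the embedded mean
energy per site `Γ E_Φ`, `densPoly σ` to `n_{0σ}`, `spinPlusPoly`/`spinMinusPoly` to `S^±_{Λ'}`.
Ingredients: `FermionInteraction.localHamiltonian`, `meanEnergyObs`, `hubbardFermionInteraction_Φ`
(singletons `U n↑n↓`, nearest-neighbour pairs `−t Σ_σ(c†c + h.c.)`, `t' = 0` kills the diagonal pairs),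
`Finset.sum` over `powerset` vs. `List.flatMap` over a `nodup` list. -/
def DictionarySound : Prop :=
  ∀ (frame : List (Site 2)), nodupSites frame = true →
    polyOp frame.toFinset (hamPoly frame) =
        (hubbardTTPrimeFermionInteraction 1 0 8).localHamiltonian frame.toFinset ∧
    (∀ h0 : thicken ({0} : Finset (Site 2)) 1 ⊆ frame.toFinset,
        polyOp frame.toFinset energyPoly =
          fermionEmbed (PolySite.incl h0) ((hubbardTTPrimeFermionInteraction 1 0 8).meanEnergyObs 1)) ∧
    (∀ (hz : (0 : Site 2) ∈ frame.toFinset) (σ : Fin 2),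
        polyOp frame.toFinset (densPoly σ) = nAt 0 hz σ) ∧
    polyOp frame.toFinset (spinPlusPoly frame) = (spinPlus : FermionOp frame.toFinset) ∧
    polyOp frame.toFinset (spinMinusPoly frame) = (spinMinus : FermionOp frame.toFinset)

/-- **S3a (M; the Hamiltonian conjunct of S3 — OPEN).** `hamPoly frame` (on-site `8·c†↑c↑c†↓c↓` per frame
site + `−1·(c†_{xσ}c_{yσ} + c†_{yσ}c_{xσ})` per nearest-neighbour frame bond) evaluates to
`H_{Λ'} = Σ_{X ⊆ Λ'} Γ Φ(X)` of `hubbardTTPrimeFermionInteraction 1 0 8`.  Ingredients: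
`FermionInteraction.localHamiltonian` (sum over `Λ'.powerset.attach`), `hubbardTTPrimeFermionInteraction_apply_singleton`
/ `_apply_pair_unitVec`, vanishing of `Φ X` on every other `X` (and of the `t' = 0` diagonal pairs), `fermionEmbed`
of `nAt`/`cAt` = the frame's `nAt`/`cAt` (`fermionEmbed_ladderLetter`), `Finset.sum` over the powerset vs. the
`List.flatMap` over the `nodup` frame list (as in `dict_spinPlus` below). -/
def HamDictSound : Prop :=
  ∀ (frame : List (Site 2)), nodupSites frame = true →
    polyOp frame.toFinset (hamPoly frame) = (hubbardTTPrimeFermionInteraction 1 0 8).localHamiltonian frame.toFinset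

theorem stub_hamDictSound : HamDictSound := by
  sorry

/-- **S3b (M; the mean-energy conjunct of S3 — OPEN).** `energyPoly` (`8·n_{0↑}n_{0↓}` + the four half-weighted bonds
at the origin `−½ Σ_σ (c†_{0σ}c_{±e_iσ} + h.c.)`) evaluates to `Γ E_Φ`, `E_Φ = Σ_{X ∋ 0} Φ(X)/|X|` on `thicken {0} 1`
embedded into the frame.  Ingredients: `FermionInteraction.meanEnergyObs` (filtered powerset sum, weights `|X|⁻¹ =
1, ½`), the same `Φ`-support facts as S3a, `fermionEmbed_comp` for `incl h0 ∘ incl`. -/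
def EnergyDictSound : Prop :=
  ∀ (frame : List (Site 2)), nodupSites frame = true →
    ∀ h0 : thicken ({0} : Finset (Site 2)) 1 ⊆ frame.toFinset,
      polyOp frame.toFinset energyPoly =
        fermionEmbed (PolySite.incl h0) ((hubbardTTPrimeFermionInteraction 1 0 8).meanEnergyObs 1)

/-! #### S3, proved parts (rev 3): the density and spin-ladder conjuncts; `stub_dictionarySound` from S3a/S3b. -/

/-- Letters of the two kinds inside the frame. -/
theorem letterOp_cre (Λ' : Finset (Site 2)) (x : Site 2) (σ : Fin 2) (h : x ∈ Λ') :
    letterOp Λ' (cre x σ) = creation (orb (PolySite.pt x h) σ) := by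
  rw [letterOp_of_mem Λ' (cre x σ) h]; simp [ladderLetter, cre]

theorem letterOp_ann (Λ' : Finset (Site 2)) (x : Site 2) (σ : Fin 2) (h : x ∈ Λ') :
    letterOp Λ' (ann x σ) = annihilation (orb (PolySite.pt x h) σ) := by
  rw [letterOp_of_mem Λ' (ann x σ) h]; simp [ladderLetter, ann]

/-- S3, density conjunct (PROVED): `polyOp (densPoly σ) = n_{0σ}`. -/
theorem dict_dens (frame : List (Site 2)) (hz : (0 : Site 2) ∈ frame.toFinset) (σ : Fin 2) :
    polyOp frame.toFinset (densPoly σ) = nAt 0 hz σ := by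
  simp only [densPoly, polyOp_cons, polyOp_nil, wordOp_cons, wordOp_nil, letterOp_cre _ _ _ hz,
    letterOp_ann _ _ _ hz, add_zero, mul_one, Rat.cast_one, one_smul]
  rfl

/-- `memSite` decides list membership. -/
theorem memSite_iff (x : Site 2) (S : List (Site 2)) : memSite x S = true ↔ x ∈ S := by
  simp [memSite, List.any_eq_true, siteEq_iff]

/-- `nodupSites` decides `List.Nodup`. -/
theorem nodup_of_nodupSites : ∀ (S : List (Site 2)), nodupSites S = true → S.Nodup
  | [], _ => List.nodup_nil
  | x :: S, h => by
      have h' : (!(memSite x S) && nodupSites S) = true := h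
      rw [Bool.and_eq_true, Bool.not_eq_true'] at h'
      refine List.nodup_cons.2 ⟨fun hx => ?_, nodup_of_nodupSites S h'.2⟩
      have hm := (memSite_iff x S).2 hx
      rw [hm] at h'
      exact Bool.false_ne_true h'.1.symm

/-- A one-coefficient polynomial evaluates to the list sum of its word operators. -/
theorem polyOp_map_one (Λ' : Finset (Site 2)) (l : List (Site 2)) (f : Site 2 → Word) :
    polyOp Λ' (l.map fun x => ((1 : ℚ), f x)) = (l.map fun x => wordOp Λ' (f x)).sum := by
  induction l with
  | nil => simp
  | cons x l ih => rw [List.map_cons, polyOp_cons, ih, List.map_cons, List.sum_cons, Rat.cast_one, one_smul]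

/-- The word `c†_{xσ} c_{xτ}` inside / outside the frame. -/
theorem wordOp_cre_ann (Λ' : Finset (Site 2)) (x : Site 2) (σ τ : Fin 2) :
    wordOp Λ' [cre x σ, ann x τ] =
      if h : x ∈ Λ' then creation (orb (PolySite.pt x h) σ) * annihilation (orb (PolySite.pt x h) τ) else 0 := by
  by_cases h : x ∈ Λ'
  · rw [dif_pos h, wordOp_cons, wordOp_cons, wordOp_nil, letterOp_cre _ _ _ h, letterOp_ann _ _ _ h, mul_one]
  · rw [dif_neg h, wordOp_cons]
    have : letterOp Λ' (cre x σ) = 0 := by simp [letterOp, cre, h]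
    rw [this, zero_mul]

/-- The sites of `Λ'` and the ordered sites `PolySite Λ'` correspond. -/
def sitesEquiv (Λ' : Finset (Site 2)) : Λ' ≃ PolySite Λ' where
  toFun x := PolySite.pt x.1 x.2
  invFun y := ⟨ofLex y.1, PolySite.ofLex_mem y⟩
  left_inv x := Subtype.ext (PolySite.ofLex_coe_pt x.1 x.2)
  right_inv y := PolySite.pt_ofLex y

/-- S3, spin-raising conjunct (PROVED): `polyOp (spinPlusPoly frame) = S⁺_{frame}`. -/
theorem dict_spinPlus (frame : List (Site 2)) (hnd : nodupSites frame = true) :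
    polyOp frame.toFinset (spinPlusPoly frame) = (spinPlus : FermionOp frame.toFinset) := by
  have hN := nodup_of_nodupSites frame hnd
  rw [spinPlusPoly, polyOp_map_one, ← List.sum_toFinset _ hN, ← Finset.sum_coe_sort]
  unfold spinPlus
  refine Fintype.sum_equiv (sitesEquiv frame.toFinset) _ _ (fun x => ?_)
  rw [wordOp_cre_ann, dif_pos x.2]
  rfl

/-- S3, spin-lowering conjunct (PROVED): `polyOp (spinMinusPoly frame) = S⁻_{frame} = (S⁺)ᴴ`. -/
theorem dict_spinMinus (frame : List (Site 2)) (hnd : nodupSites frame = true) :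
    polyOp frame.toFinset (spinMinusPoly frame) = (spinMinus : FermionOp frame.toFinset) := by
  rw [spinMinus, ← dict_spinPlus frame hnd, spinPlusPoly, spinMinusPoly, polyOp_map_one, polyOp_map_one,
    Matrix.conjTranspose_list_sum, List.map_map]
  congr 1
  refine List.map_congr_left (fun x _ => ?_)
  simp only [Function.comp]
  rw [wordOp_cre_ann, wordOp_cre_ann]
  by_cases h : x ∈ frame.toFinset
  · rw [dif_pos h, dif_pos h, Matrix.conjTranspose_mul, creation_conjTranspose, annihilation_conjTranspose]
  · rw [dif_neg h, dif_neg h, Matrix.conjTranspose_zero]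

/-! #### S3b `EnergyDictSound`, PROVED (rev 5): `energyPoly` IS the `tt'(1,0,8)` mean-energy observable read in
the frame — from the tree's closed forms `hubbardTTPrimeFermionInteraction_meanEnergyObs`,
`hubbardFermionInteraction_meanEnergyObs` (on-site term at `0` + half of each of the four bonds through `0`),
`hubbardFermionInteraction_apply_singleton/_apply_pair`, and `(diagHoppingFermionInteraction 0).meanEnergyObs = 0`. -/

/-- At `t' = 0` the diagonal-hopping interaction has zero mean-energy observable. -/
theorem diagHopping_zero_meanEnergyObs (R : ℝ) : (diagHoppingFermionInteraction 0).meanEnergyObs R = 0 := by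
  unfold FermionInteraction.meanEnergyObs
  refine Finset.sum_eq_zero fun X _ => ?_
  have h : (diagHoppingFermionInteraction 0).Φ X.1 = 0 := by
    unfold diagHoppingFermionInteraction; simp
  rw [h, map_zero, smul_zero]

theorem unitVec_zero_eq_e1 : (unitVec 0 : Site 2) = e1 := by
  funext j; fin_cases j <;> simp [e1]

theorem unitVec_one_eq_e2 : (unitVec 1 : Site 2) = e2 := by
  funext j; fin_cases j <;> simp [e2]

/-- A two-letter word `c†_{xσ} c_{yτ}` inside the frame. -/
theorem wordOp_cre_ann₂ (Λ' : Finset (Site 2)) (x y : Site 2) (σ τ : Fin 2) (hx : x ∈ Λ') (hy : y ∈ Λ') :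
    wordOp Λ' [cre x σ, ann y τ] = creation (orb (PolySite.pt x hx) σ) * annihilation (orb (PolySite.pt y hy) τ) := by
  rw [wordOp_cons, wordOp_cons, wordOp_nil, letterOp_cre _ _ _ hx, letterOp_ann _ _ _ hy, mul_one]

/-- The operator of `hop q x y`. -/
theorem polyOp_hop (Λ' : Finset (Site 2)) (q : ℚ) (x y : Site 2) (hx : x ∈ Λ') (hy : y ∈ Λ') :
    polyOp Λ' (hop q x y) =
      ((q : ℚ) : ℂ) • ∑ σ : Fin 2,
        (creation (orb (PolySite.pt x hx) σ) * annihilation (orb (PolySite.pt y hy) σ) +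
          creation (orb (PolySite.pt y hy) σ) * annihilation (orb (PolySite.pt x hx) σ)) := by
  simp only [hop, List.flatMap_cons, List.flatMap_nil, List.append_nil, List.cons_append, List.nil_append,
    polyOp_cons, polyOp_nil, wordOp_cre_ann₂ _ _ _ _ _ hx hy, wordOp_cre_ann₂ _ _ _ _ _ hy hx, Fin.sum_univ_two,
    smul_add, add_zero]
  abel

/-- The operator of `onsite q x`. -/
theorem polyOp_onsite (Λ' : Finset (Site 2)) (q : ℚ) (x : Site 2) (hx : x ∈ Λ') :
    polyOp Λ' (onsite q x) =
      ((q : ℚ) : ℂ) • (creation (orb (PolySite.pt x hx) 0) * annihilation (orb (PolySite.pt x hx) 0) *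
        (creation (orb (PolySite.pt x hx) 1) * annihilation (orb (PolySite.pt x hx) 1))) := by
  simp only [onsite, polyOp_cons, polyOp_nil, wordOp_cons, wordOp_nil, letterOp_cre _ _ _ hx, letterOp_ann _ _ _ hx,
    mul_one, add_zero, mul_assoc]

/-- The embedded on-site term of the Hubbard interaction. -/
theorem embed_hubbard_singleton {Λ' : Finset (Site 2)} (t U : ℝ) (x : Site 2) (hx : x ∈ Λ')
    (h : ({x} : Finset (Site 2)) ⊆ Λ') :
    fermionEmbed (PolySite.incl h) ((hubbardFermionInteraction 2 t U).Φ {x}) =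
      (U : ℂ) • (creation (orb (PolySite.pt x hx) 0) * annihilation (orb (PolySite.pt x hx) 0) *
        (creation (orb (PolySite.pt x hx) 1) * annihilation (orb (PolySite.pt x hx) 1))) := by
  rw [hubbardFermionInteraction_apply_singleton, map_smul, map_mul]
  simp only [numberOp, map_mul, fermionEmbed_creation, fermionEmbed_annihilation, PolySite.incl_pt]

/-- The embedded bond term of the Hubbard interaction, with the two sites renamed propositionally. -/
theorem embed_hubbard_pair {Λ' : Finset (Site 2)} (t U : ℝ) (x₀ : Site 2) (i : Fin 2) (x y : Site 2)
    (hxe : x₀ = x) (hye : x₀ + unitVec i = y) (hx : x ∈ Λ') (hy : y ∈ Λ')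
    (h : ({x₀, x₀ + unitVec i} : Finset (Site 2)) ⊆ Λ') :
    fermionEmbed (PolySite.incl h) ((hubbardFermionInteraction 2 t U).Φ {x₀, x₀ + unitVec i}) =
      -(t : ℂ) • ∑ σ : Fin 2,
        (creation (orb (PolySite.pt x hx) σ) * annihilation (orb (PolySite.pt y hy) σ) +
          creation (orb (PolySite.pt y hy) σ) * annihilation (orb (PolySite.pt x hx) σ)) := by
  subst hxe; subst hye
  rw [hubbardFermionInteraction_apply_pair, map_smul, map_sum]
  simp only [map_add, map_mul, annihilation_conjTranspose, fermionEmbed_creation, fermionEmbed_annihilation,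
    PolySite.incl_pt]

theorem stub_energyDictSound : EnergyDictSound := by
  intro frame hnd h0
  have hz : (0 : Site 2) ∈ frame.toFinset := h0 (zero_mem_thicken_zero 1)
  have he1 : e1 ∈ frame.toFinset := h0 (unitVec_zero_eq_e1 ▸ unitVec_mem_thicken_one 0)
  have he2 : e2 ∈ frame.toFinset := h0 (unitVec_one_eq_e2 ▸ unitVec_mem_thicken_one 1)
  have hne1 : -e1 ∈ frame.toFinset := h0 (unitVec_zero_eq_e1 ▸ neg_unitVec_mem_thicken_one 0)
  have hne2 : -e2 ∈ frame.toFinset := h0 (unitVec_one_eq_e2 ▸ neg_unitVec_mem_thicken_one 1)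
  -- the tree side
  rw [hubbardTTPrimeFermionInteraction_meanEnergyObs, diagHopping_zero_meanEnergyObs, add_zero,
    hubbardFermionInteraction_meanEnergyObs]
  simp only [map_add, map_smul, fermionEmbed_fermionEmbed, PolySite.incl_trans, Fin.sum_univ_two]
  rw [embed_hubbard_singleton 1 8 0 hz,
    embed_hubbard_pair 1 8 0 0 0 e1 rfl (by rw [zero_add, unitVec_zero_eq_e1]) hz he1,
    embed_hubbard_pair 1 8 0 1 0 e2 rfl (by rw [zero_add, unitVec_one_eq_e2]) hz he2,
    embed_hubbard_pair 1 8 (-unitVec 0) 0 (-e1) 0 (by rw [unitVec_zero_eq_e1]) (by rw [neg_add_cancel]) hne1 hz,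
    embed_hubbard_pair 1 8 (-unitVec 1) 1 (-e2) 0 (by rw [unitVec_one_eq_e2]) (by rw [neg_add_cancel]) hne2 hz]
  -- the checker side
  rw [energyPoly, polyOp_append, polyOp_append, polyOp_append, polyOp_append, polyOp_onsite _ _ _ hz,
    polyOp_hop _ _ _ _ hz he1, polyOp_hop _ _ _ _ hz he2, polyOp_hop _ _ _ _ hne1 hz, polyOp_hop _ _ _ _ hne2 hz]
  simp only [smul_smul]
  push_cast
  norm_num
  abel

/-- **S3 assembled**: the dictionary, from the two open Hamiltonian conjuncts S3a/S3b and the proved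
density / spin-ladder conjuncts. -/
theorem stub_dictionarySound : DictionarySound := fun frame hnd =>
  ⟨stub_hamDictSound frame hnd, stub_energyDictSound frame hnd, fun hz σ => dict_dens frame hz σ,
    dict_spinPlus frame hnd, dict_spinMinus frame hnd⟩

/-- Soundness of the checker, as a statement: a passing syntactic certificate is a Ward × `D₄` window
certificate of value `symValue K` in the sense of line `wardk` (`WardD4CertGe`). -/
def SymCheckSound : Prop :=
  ∀ K : SymCert, symCheck K = true → WardD4CertGe ((symValue K : ℚ) : ℝ)

/-! #### S4 `stub_soundOfKernels` — PROOF (hub-lb-sym-eng-3 g1, 2026-08-28).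
Route (design note N1 on the cell bus 08:47Z): the witness of `WardD4CertGe` takes `Λ := frame`,
`Λ' := Λ'⁺ := thicken frame 1 ∪ ⋃_{identification uses} d4ShiftSet γ v frame` ⊋ frame, so that every
PER-WORD licensed move of `canonA` / `moves` is licensed for the single inner window `Λ = frame` of
`WardD4Identity`; the identity is read in `𝔄_{Λ'⁺}` and the two frame-level commutator families are
transferred by graded locality (`[H_{Λ'⁺}, ΓB] = Γ[H_frame, B]`, `[S^±_{Λ'⁺}, ΓX] = Γ[S^±_frame, X]`). -/

section S4Sound

/-! ##### (a) `polyOp` algebra -/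

theorem wordOp_append (Λ' : Finset (Site 2)) (u v : Word) :
    wordOp Λ' (u ++ v) = wordOp Λ' u * wordOp Λ' v := by
  simp [wordOp, List.map_append, List.prod_append]

theorem polyOp_pscale (Λ' : Finset (Site 2)) (q : ℚ) (p : QPoly) :
    polyOp Λ' (pscale q p) = ((q : ℚ) : ℂ) • polyOp Λ' p :=
  polyOp_map_mul Λ' q p

theorem polyOp_psub (Λ' : Finset (Site 2)) (p r : QPoly) :
    polyOp Λ' (psub p r) = polyOp Λ' p - polyOp Λ' r := by
  rw [psub, polyOp_append, polyOp_pscale, Rat.cast_neg, Rat.cast_one, neg_one_smul, sub_eq_add_neg]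

theorem polyOp_map_mulWord (Λ' : Finset (Site 2)) (t : ℚ × Word) (r : QPoly) :
    polyOp Λ' (r.map fun t' => (t.1 * t'.1, t.2 ++ t'.2)) = ((t.1 : ℚ) : ℂ) • (wordOp Λ' t.2 * polyOp Λ' r) := by
  induction r with
  | nil => simp
  | cons t' r ih =>
    rw [List.map_cons, polyOp_cons, ih, polyOp_cons, mul_add, smul_add, wordOp_append, Rat.cast_mul, mul_smul,
      mul_smul_comm]

theorem polyOp_pmul (Λ' : Finset (Site 2)) (p r : QPoly) :
    polyOp Λ' (pmul p r) = polyOp Λ' p * polyOp Λ' r := by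
  induction p with
  | nil => simp [pmul]
  | cons t p ih =>
    have h : pmul (t :: p) r = (r.map fun t' => (t.1 * t'.1, t.2 ++ t'.2)) ++ pmul p r := rfl
    rw [h, polyOp_append, ih, polyOp_map_mulWord, polyOp_cons, add_mul, smul_mul_assoc]

theorem letterOp_adj (Λ' : Finset (Site 2)) (ℓ : Letter) : letterOp Λ' ℓ.adj = (letterOp Λ' ℓ)ᴴ := by
  by_cases h : ℓ.x ∈ Λ'
  · have h' : ℓ.adj.x ∈ Λ' := h
    rw [letterOp_of_mem Λ' ℓ h, letterOp_of_mem Λ' ℓ.adj h']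
    show ladderLetter (orb (PolySite.pt ℓ.x h) ℓ.s, !ℓ.dag) = _
    cases ℓ.dag <;> simp [ladderLetter, creation_conjTranspose, annihilation_conjTranspose]
  · have h' : ¬ ℓ.adj.x ∈ Λ' := h
    simp [letterOp, h, h']

theorem wordOp_adjWord (Λ' : Finset (Site 2)) (w : Word) : wordOp Λ' (adjWord w) = (wordOp Λ' w)ᴴ := by
  induction w with
  | nil => simp [adjWord, wordOp]
  | cons ℓ w ih =>
    have h : adjWord (ℓ :: w) = adjWord w ++ [ℓ.adj] := by simp [adjWord]
    rw [h, wordOp_append, ih, wordOp_cons, wordOp_cons, wordOp_nil, mul_one, letterOp_adj,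
      Matrix.conjTranspose_mul]

theorem polyOp_padj (Λ' : Finset (Site 2)) (p : QPoly) : polyOp Λ' (padj p) = (polyOp Λ' p)ᴴ := by
  induction p with
  | nil => simp [padj]
  | cons t p ih =>
    have h : padj (t :: p) = (t.1, adjWord t.2) :: padj p := rfl
    rw [h, polyOp_cons, ih, polyOp_cons, Matrix.conjTranspose_add, Matrix.conjTranspose_smul, wordOp_adjWord]
    congr 1
    rw [← Complex.ofReal_ratCast, Complex.star_def, Complex.conj_ofReal]

theorem polyOp_comm (Λ' : Finset (Site 2)) (p r : QPoly) :
    polyOp Λ' (comm p r) = polyOp Λ' p * polyOp Λ' r - polyOp Λ' r * polyOp Λ' p := by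
  rw [comm, polyOp_psub, polyOp_pmul, polyOp_pmul]

theorem polyOp_flatMap (Λ' : Finset (Site 2)) {α : Type*} (l : List α) (f : α → QPoly) :
    polyOp Λ' (l.flatMap f) = (l.map fun a => polyOp Λ' (f a)).sum := by
  induction l with
  | nil => simp
  | cons a l ih => rw [List.flatMap_cons, polyOp_append, ih, List.map_cons, List.sum_cons]

theorem polyOp_single (Λ' : Finset (Site 2)) (q : ℚ) (w : Word) : polyOp Λ' [(q, w)] = ((q : ℚ) : ℂ) • wordOp Λ' w := by
  rw [polyOp_cons, polyOp_nil, add_zero]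

/-- Faithfulness of `nfPoly` on supported polynomials (from S1). -/
theorem polyOp_nfPoly (h1 : NfFaithful) (Λ' : Finset (Site 2)) (p : QPoly) (hp : ∀ t ∈ p, SuppIn t.2 Λ') :
    polyOp Λ' (nfPoly p) = polyOp Λ' p := by
  induction p with
  | nil => simp [nfPoly]
  | cons t p ih =>
    have h : nfPoly (t :: p) = pscale t.1 (nfWord t.2) ++ nfPoly p := rfl
    rw [h, polyOp_append, ih (fun s hs => hp s (List.mem_cons_of_mem _ hs)), polyOp_cons, polyOp_pscale,
      ← h1 Λ' t.2 (hp t List.mem_cons_self)]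

/-- Isotony for polynomials supported in the smaller window. -/
theorem polyOp_incl {Λ Λ' : Finset (Site 2)} (hΛ : Λ ⊆ Λ') (p : QPoly) (hp : ∀ t ∈ p, SuppIn t.2 Λ) :
    polyOp Λ' p = fermionEmbed (PolySite.incl hΛ) (polyOp Λ p) := by
  induction p with
  | nil => simp
  | cons t p ih =>
    rw [polyOp_cons, polyOp_cons, map_add, map_smul, ← ih (fun s hs => hp s (List.mem_cons_of_mem _ hs)),
      ← wordOp_incl hΛ t.2 (hp t List.mem_cons_self)]

/-! ##### (b) Boolean side conditions ⇒ propositions -/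

theorem suppIn_iff (w : Word) (S : List (Site 2)) : suppIn w S = true ↔ ∀ ℓ ∈ w, ℓ.x ∈ S := by
  simp [suppIn, List.all_eq_true, memSite_iff]

theorem SuppIn_of_suppIn {w : Word} {S : List (Site 2)} (h : suppIn w S = true) : SuppIn w S.toFinset :=
  fun ℓ hℓ => List.mem_toFinset.2 ((suppIn_iff w S).1 h ℓ hℓ)

theorem psuppIn_iff (p : QPoly) (S : List (Site 2)) : psuppIn p S = true ↔ ∀ t ∈ p, suppIn t.2 S = true := by
  simp [psuppIn, List.all_eq_true]

theorem subSites_iff (S T : List (Site 2)) : subSites S T = true ↔ ∀ x ∈ S, x ∈ T := by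
  simp [subSites, List.all_eq_true, memSite_iff]

theorem SuppIn.mono {w : Word} {Λ Λ' : Finset (Site 2)} (h : Λ ⊆ Λ') (hw : SuppIn w Λ) : SuppIn w Λ' :=
  fun ℓ hℓ => h (hw ℓ hℓ)

theorem SuppIn_append {u v : Word} {Λ : Finset (Site 2)} : SuppIn (u ++ v) Λ ↔ SuppIn u Λ ∧ SuppIn v Λ := by
  simp only [SuppIn, List.mem_append]
  exact ⟨fun h => ⟨fun ℓ hℓ => h ℓ (Or.inl hℓ), fun ℓ hℓ => h ℓ (Or.inr hℓ)⟩,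
    fun h ℓ hℓ => hℓ.elim (h.1 ℓ) (h.2 ℓ)⟩

theorem SuppIn_adjWord {w : Word} {Λ : Finset (Site 2)} (hw : SuppIn w Λ) : SuppIn (adjWord w) Λ := by
  intro ℓ hℓ
  simp only [adjWord, List.mem_reverse, List.mem_map] at hℓ
  obtain ⟨m, hm, rfl⟩ := hℓ
  exact hw m hm

/-- `nodupSites` from `List.Nodup` (converse of `nodup_of_nodupSites`). -/
theorem nodupSites_of_nodup : ∀ (S : List (Site 2)), S.Nodup → nodupSites S = true
  | [], _ => rfl
  | x :: S, h => by
      have h' := List.nodup_cons.1 h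
      have hx : memSite x S = false := by
        cases hm : memSite x S
        · rfl
        · exact absurd ((memSite_iff x S).1 hm) h'.1
      show (!(memSite x S) && nodupSites S) = true
      rw [hx, nodupSites_of_nodup S h'.2]
      rfl

/-- A vector of the unit box is one of the nine king moves. -/
theorem add_mem_nbhd_of_mem_box {y v : Site 2} (hv : v ∈ box 2 1) : y + v ∈ nbhd y := by
  rw [mem_box] at hv
  have hv' : v = ![v 0, v 1] := by funext j; fin_cases j <;> rfl
  obtain ⟨h0a, h0b⟩ := hv 0
  obtain ⟨h1a, h1b⟩ := hv 1
  simp only [Nat.cast_one] at h0a h0b h1a h1b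
  simp only [nbhd, List.mem_flatMap, List.mem_map, List.mem_cons, List.not_mem_nil, or_false]
  refine ⟨v 0, ?_, v 1, ?_, by rw [← hv']⟩
  · interval_cases (v 0) <;> simp
  · interval_cases (v 1) <;> simp

/-- `subSites (thick S) frame` ⇒ `thicken S 1 ⊆ frame` (as finsets). -/
theorem thicken_subset_of_thick {S fr : List (Site 2)} (h : subSites (thick S) fr = true) :
    thicken S.toFinset 1 ⊆ fr.toFinset := by
  intro z hz
  rw [thicken, Finset.mem_biUnion] at hz
  obtain ⟨y, hy, hz⟩ := hz
  rw [Nat.floor_one, Finset.mem_image] at hz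
  obtain ⟨v, hv, rfl⟩ := hz
  have hmem : y + v ∈ thick S := List.mem_flatMap.2 ⟨y, List.mem_toFinset.1 hy, add_mem_nbhd_of_mem_box hv⟩
  exact List.mem_toFinset.2 ((subSites_iff _ _).1 h _ hmem)

/-! ##### (c) Raw words as tree ladder words; charges -/

/-- A raw letter as an orbital letter of `Λ'` (junk orbital at `0` outside the frame). -/
def orbLetter (Λ' : Finset (Site 2)) (hz : (0 : Site 2) ∈ Λ') (ℓ : Letter) : Orb (PolySite Λ') × Bool :=
  (if h : ℓ.x ∈ Λ' then orb (PolySite.pt ℓ.x h) ℓ.s else orb (PolySite.pt 0 hz) ℓ.s, ℓ.dag)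

/-- A raw word as a tree ladder word. -/
def orbWord (Λ' : Finset (Site 2)) (hz : (0 : Site 2) ∈ Λ') (w : Word) : List (Orb (PolySite Λ') × Bool) :=
  w.map (orbLetter Λ' hz)

theorem ladderLetter_orbLetter (Λ' : Finset (Site 2)) (hz : (0 : Site 2) ∈ Λ') (ℓ : Letter) (h : ℓ.x ∈ Λ') :
    ladderLetter (orbLetter Λ' hz ℓ) = letterOp Λ' ℓ := by
  rw [orbLetter, dif_pos h, letterOp_of_mem Λ' ℓ h]

theorem ladderWord_orbWord (Λ' : Finset (Site 2)) (hz : (0 : Site 2) ∈ Λ') (w : Word) (hw : SuppIn w Λ') :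
    ladderWord (orbWord Λ' hz w) = wordOp Λ' w := by
  induction w with
  | nil => simp [orbWord, wordOp]
  | cons ℓ w ih =>
    have h : orbWord Λ' hz (ℓ :: w) = orbLetter Λ' hz ℓ :: orbWord Λ' hz w := rfl
    rw [h, ladderWord_cons, ih (fun m hm => hw m (List.mem_cons_of_mem _ hm)), wordOp_cons,
      ladderLetter_orbLetter _ _ _ (hw ℓ List.mem_cons_self)]

theorem ladderCharge_orbWord (Λ' : Finset (Site 2)) (hz : (0 : Site 2) ∈ Λ') (w : Word) :
    ladderCharge (orbWord Λ' hz w) = wordCharge w := by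
  simp only [ladderCharge, orbWord, wordCharge, List.map_map]
  rfl

theorem ladderSpinCharge_orbWord (Λ' : Finset (Site 2)) (hz : (0 : Site 2) ∈ Λ') (w : Word) :
    ladderSpinCharge (orbWord Λ' hz w) = wordSpinCharge w := by
  simp only [ladderSpinCharge, orbWord, wordSpinCharge, List.map_map]
  congr 1
  refine List.map_congr_left fun ℓ _ => ?_
  have hs : (ofLex (if h : ℓ.x ∈ Λ' then orb (PolySite.pt ℓ.x h) ℓ.s else orb (PolySite.pt 0 hz) ℓ.s)).2 = ℓ.s := by
    split <;> rfl
  simp only [Function.comp, letterSpinCharge, orbLetter, hs]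
  split_ifs <;> rfl

/-! ##### (d) List sums as `Fin`-indexed sums; the diagonal Gram form; casts -/

theorem sum_fin_get {M : Type*} [AddCommMonoid M] {α : Type*} (l : List α) (f : α → M) :
    ∑ k : Fin l.length, f (l.get k) = (l.map f).sum := by
  rw [Fin.sum_univ_def, show (fun k : Fin l.length => f (l.get k)) = f ∘ l.get from rfl, ← List.map_map,
    List.map_get_finRange]

theorem gramForm_diagonal_fin {Λ' : Finset (Site 2)} {n : ℕ} (d : Fin n → ℂ) (O : Fin n → FermionOp Λ') :
    gramForm (Matrix.diagonal d) O = ∑ k, d k • ((O k)ᴴ * O k) := by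
  unfold gramForm
  refine Finset.sum_congr rfl fun i _ => ?_
  rw [Finset.sum_eq_single i]
  · rw [Matrix.diagonal_apply_eq, Matrix.star_eq_conjTranspose]
  · intro j _ hji
    rw [Matrix.diagonal_apply_ne _ (Ne.symm hji), zero_smul]
  · intro hi; exact absurd (Finset.mem_univ i) hi

theorem qabs_eq_abs (q : ℚ) : qabs q = |q| := by
  unfold qabs
  split_ifs with h
  · exact (abs_of_neg h).symm
  · exact (abs_of_nonneg (le_of_not_gt h)).symm

theorem norm_ratCast_complex (q : ℚ) : ‖((q : ℚ) : ℂ)‖ = ((|q| : ℚ) : ℝ) := by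
  rw [← Complex.ofReal_ratCast, Complex.norm_real, Real.norm_eq_abs, Rat.cast_abs]

/-! ##### (e) Graded locality: frame-level commutators transferred to a larger frame -/

/-- **`[H_{Λ'}, ΓB] = Γ[H_F, B]`** for `B ∈ Γ𝔄_I`, `thicken I 1 ⊆ F ⊆ Λ'` (both sides are the embedded
`[H_{thicken I 1}, B]`, tree `hubbardTTPrime_localHamiltonian_commutator_fermionEmbed_eq`). -/
theorem ham_commutator_transfer {I F L : Finset (Site 2)} (hIF : I ⊆ F) (hth : thicken I 1 ⊆ F) (hFL : F ⊆ L)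
    (A : FermionOp I) :
    (hubbardTTPrimeFermionInteraction 1 0 8).localHamiltonian L *
          fermionEmbed (PolySite.incl hFL) (fermionEmbed (PolySite.incl hIF) A) -
        fermionEmbed (PolySite.incl hFL) (fermionEmbed (PolySite.incl hIF) A) *
          (hubbardTTPrimeFermionInteraction 1 0 8).localHamiltonian L =
      fermionEmbed (PolySite.incl hFL)
        ((hubbardTTPrimeFermionInteraction 1 0 8).localHamiltonian F * fermionEmbed (PolySite.incl hIF) A -
          fermionEmbed (PolySite.incl hIF) A * (hubbardTTPrimeFermionInteraction 1 0 8).localHamiltonian F) := by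
  rw [hubbardTTPrime_localHamiltonian_commutator_fermionEmbed_eq 1 0 8 hIF hth A, fermionEmbed_fermionEmbed,
    fermionEmbed_fermionEmbed, PolySite.incl_trans, PolySite.incl_trans,
    hubbardTTPrime_localHamiltonian_commutator_fermionEmbed_eq 1 0 8 (hIF.trans hFL) (hth.trans hFL) A]

/-- **`[S⁺_{Λ'}, ΓZ] = Γ[S⁺_F, Z]`** for `Z ∈ 𝔄_F`, `F ⊆ Λ'`: the on-site terms `c†_{y↑}c_{y↓}` off the image of
`F` are even and far from `ΓZ` (FermionEmbedLocality). -/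
theorem spinPlus_commutator_transfer {F L : Finset (Site 2)} (hFL : F ⊆ L) (Z : FermionOp F) :
    (spinPlus : FermionOp L) * fermionEmbed (PolySite.incl hFL) Z - fermionEmbed (PolySite.incl hFL) Z * spinPlus =
      fermionEmbed (PolySite.incl hFL) ((spinPlus : FermionOp F) * Z - Z * spinPlus) := by
  classical
  set φ := PolySite.incl hFL with hφ
  set T : Finset (PolySite L) := Finset.univ.map φ with hT
  let g : PolySite L → FermionOp L := fun a => creation (orb a 0) * annihilation (orb a 1)
  have hS : (spinPlus : FermionOp L) = ∑ a, g a := rfl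
  have himage : ∑ a ∈ T, g a = fermionEmbed φ (spinPlus : FermionOp F) := by
    rw [hT, Finset.sum_map, spinPlus, fermionEmbed_sum]
    exact Finset.sum_congr rfl fun p _ => by rw [map_mul, fermionEmbed_creation, fermionEmbed_annihilation]
  have hfar : ∑ a ∈ Tᶜ, g a ∈ carEvenSubalgebra (orbs Tᶜ) := by
    refine Subalgebra.sum_mem _ fun a ha => carEvenSubalgebra_mono (fun i hi => ?_)
      (creation_mul_annihilation_mem_carEvenSubalgebra (orb_mem_orbs.2 (Finset.mem_singleton_self a))
        (orb_mem_orbs.2 (Finset.mem_singleton_self a)))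
    rw [mem_orbs, Finset.mem_singleton] at hi
    rw [mem_orbs, hi]
    exact ha
  have hdis : Disjoint (orbs Tᶜ) (orbs ((Finset.univ : Finset (PolySite F)).map φ)) := by
    rw [Finset.disjoint_left]
    intro i hi hi'
    rw [mem_orbs] at hi hi'
    exact (Finset.mem_compl.1 hi) hi'
  have hcomm : Commute (∑ a ∈ Tᶜ, g a) (fermionEmbed φ Z) :=
    commute_of_mem_carEvenSubalgebra hfar (fermionEmbed_mem_carSubalgebra φ Z) hdis
  rw [hS, ← Finset.sum_add_sum_compl T, himage, add_mul, mul_add,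
    hcomm.eq, add_sub_add_right_eq_sub, ← fermionEmbed_mul, ← fermionEmbed_mul, ← fermionEmbed_sub]

/-- **`[S⁻_{Λ'}, ΓZ] = Γ[S⁻_F, Z]`** (adjoint of the `S⁺` transfer). -/
theorem spinMinus_commutator_transfer {F L : Finset (Site 2)} (hFL : F ⊆ L) (Z : FermionOp F) :
    (spinMinus : FermionOp L) * fermionEmbed (PolySite.incl hFL) Z - fermionEmbed (PolySite.incl hFL) Z * spinMinus =
      fermionEmbed (PolySite.incl hFL) ((spinMinus : FermionOp F) * Z - Z * spinMinus) := by
  have h := congrArg Matrix.conjTranspose (spinPlus_commutator_transfer hFL Zᴴ)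
  simp only [Matrix.conjTranspose_sub, Matrix.conjTranspose_mul, ← fermionEmbed_conjTranspose,
    Matrix.conjTranspose_conjTranspose] at h
  rw [spinMinus, spinMinus, ← neg_sub, h, ← map_neg, neg_sub]


/-! ##### (f) Shape of normal words: creators, then annihilators ⇒ moved normal words have ≤ 1-term
normal forms (this is what makes `leadNegOf`'s head comparison a complete test) -/

/-- All letters are annihilators. -/
def allAnn (w : Word) : Bool := w.all fun ℓ => !ℓ.dag

/-- "Creators, then annihilators" — the shape of every word `nfWord` outputs. -/
def caWord : Word → Bool
  | [] => true
  | ℓ :: w => if ℓ.dag then caWord w else allAnn w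

theorem allAnn_cons (ℓ : Letter) (w : Word) : allAnn (ℓ :: w) = (!ℓ.dag && allAnn w) := rfl

theorem caWord_cons_true {ℓ : Letter} (h : ℓ.dag = true) (w : Word) : caWord (ℓ :: w) = caWord w := by
  rw [caWord, h, if_pos rfl]

theorem caWord_cons_false {ℓ : Letter} (h : ℓ.dag = false) (w : Word) : caWord (ℓ :: w) = allAnn w := by
  rw [caWord, h]; rfl

theorem caWord_of_allAnn : ∀ w, allAnn w = true → caWord w = true
  | [], _ => rfl
  | ℓ :: w, h => by
    rw [allAnn_cons, Bool.and_eq_true] at h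
    have hℓ : ℓ.dag = false := by simpa using h.1
    rw [caWord_cons_false hℓ]; exact h.2

theorem allAnn_of_subset {u w : Word} (h : u ⊆ w) (hw : allAnn w = true) : allAnn u = true := by
  simp only [allAnn, List.all_eq_true] at hw ⊢
  exact fun ℓ hℓ => hw ℓ (h hℓ)

theorem insL_allAnn (ℓ : Letter) (hℓ : ℓ.dag = false) :
    ∀ u, allAnn u = true → ∀ t ∈ insL ℓ u, allAnn t.2 = true
  | [], _, t, ht => by
    simp only [insL, List.mem_singleton] at ht
    subst ht
    simp [allAnn, hℓ]
  | m :: rest, hu, t, ht => by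
    rw [allAnn_cons, Bool.and_eq_true] at hu
    have hm : m.dag = false := by simpa using hu.1
    simp only [insL, hℓ, hm, Bool.false_eq_true, if_false] at ht
    split_ifs at ht with h1 h2
    · simp at ht
    · simp only [List.mem_singleton] at ht
      subst ht
      show allAnn (ℓ :: m :: rest) = true
      rw [allAnn_cons, allAnn_cons, hℓ, hm]; simpa using hu.2
    · simp only [consNeg, List.mem_map] at ht
      obtain ⟨t0, ht0, rfl⟩ := ht
      show allAnn (m :: t0.2) = true
      rw [allAnn_cons, hm]
      simpa using insL_allAnn ℓ hℓ rest hu.2 t0 ht0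

theorem insL_ca (ℓ : Letter) : ∀ u, caWord u = true → ∀ t ∈ insL ℓ u, caWord t.2 = true
  | [], _, t, ht => by
    simp only [insL, List.mem_singleton] at ht
    subst ht
    show caWord [ℓ] = true
    cases h : ℓ.dag
    · rw [caWord_cons_false h]; rfl
    · rw [caWord_cons_true h]; rfl
  | m :: rest, hu, t, ht => by
    cases hd : ℓ.dag <;> cases hmd : m.dag
    · -- both annihilators
      have hrest : allAnn rest = true := by rw [caWord_cons_false hmd] at hu; exact hu
      have hall : allAnn (m :: rest) = true := by rw [allAnn_cons, hmd]; simpa using hrest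
      exact caWord_of_allAnn _ (insL_allAnn ℓ hd (m :: rest) hall t ht)
    · -- ℓ annihilator, m creator
      have hrest : caWord rest = true := by rw [caWord_cons_true hmd] at hu; exact hu
      simp only [insL, hd, hmd, Bool.false_eq_true, if_false, if_true, List.mem_append] at ht
      rcases ht with ht | ht
      · split_ifs at ht with he
        · simp only [List.mem_singleton] at ht; subst ht; exact hrest
        · simp at ht
      · simp only [consNeg, List.mem_map] at ht
        obtain ⟨t0, ht0, rfl⟩ := ht
        show caWord (m :: t0.2) = true
        rw [caWord_cons_true hmd]; exact insL_ca ℓ rest hrest t0 ht0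
    · -- ℓ creator, m annihilator
      simp only [insL, hd, hmd, Bool.false_eq_true, if_false, if_true, List.mem_singleton] at ht
      subst ht
      show caWord (ℓ :: m :: rest) = true
      rw [caWord_cons_true hd]; exact hu
    · -- both creators
      have hrest : caWord rest = true := by rw [caWord_cons_true hmd] at hu; exact hu
      simp only [insL, hd, hmd, if_true] at ht
      split_ifs at ht with he hl
      · simp at ht
      · simp only [List.mem_singleton] at ht; subst ht
        show caWord (ℓ :: m :: rest) = true
        rw [caWord_cons_true hd]; exact hu
      · simp only [consNeg, List.mem_map] at ht
        obtain ⟨t0, ht0, rfl⟩ := ht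
        show caWord (m :: t0.2) = true
        rw [caWord_cons_true hmd]; exact insL_ca ℓ rest hrest t0 ht0

/-- Every word `nfWord` outputs is creators-then-annihilators. -/
theorem nfWord_ca : ∀ (w : Word), ∀ t ∈ nfWord w, caWord t.2 = true
  | [], t, ht => by
    simp only [nfWord, List.mem_singleton] at ht
    subst ht; rfl
  | ℓ :: w, t, ht => by
    simp only [nfWord, List.mem_flatMap, List.mem_map] at ht
    obtain ⟨t0, ht0, t1, ht1, rfl⟩ := ht
    exact insL_ca ℓ t0.2 (nfWord_ca w t0 ht0) t1 ht1

theorem insL_length_le (ℓ : Letter) :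
    ∀ u, ((ℓ.dag = true ∧ caWord u = true) ∨ (ℓ.dag = false ∧ allAnn u = true)) → (insL ℓ u).length ≤ 1
  | [], _ => by simp [insL]
  | m :: rest, h => by
    rcases h with ⟨hd, hu⟩ | ⟨hd, hu⟩
    · cases hmd : m.dag
      · simp [insL, hd, hmd]
      · have hrest : caWord rest = true := by rw [caWord_cons_true hmd] at hu; exact hu
        simp only [insL, hd, hmd, if_true]
        split_ifs
        · simp
        · simp
        · rw [consNeg, List.length_map]; exact insL_length_le ℓ rest (Or.inl ⟨hd, hrest⟩)
    · rw [allAnn_cons, Bool.and_eq_true] at hu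
      have hmd : m.dag = false := by simpa using hu.1
      simp only [insL, hd, hmd, Bool.false_eq_true, if_false]
      split_ifs
      · simp
      · simp
      · rw [consNeg, List.length_map]; exact insL_length_le ℓ rest (Or.inr ⟨hd, hu.2⟩)

/-- The normal form of a creators-then-annihilators word has at most one term (no `δ` branch fires). -/
theorem nfWord_length_le : ∀ (w : Word), caWord w = true → (nfWord w).length ≤ 1
  | [], _ => by simp [nfWord]
  | ℓ :: w, h => by
    have hw : caWord w = true := by
      cases hd : ℓ.dag
      · rw [caWord_cons_false hd] at h; exact caWord_of_allAnn w h
      · rw [caWord_cons_true hd] at h; exact h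
    have ih := nfWord_length_le w hw
    show ((nfWord w).flatMap fun t => (insL ℓ t.2).map fun t' => (t.1 * t'.1, t'.2)).length ≤ 1
    rcases hn : nfWord w with _ | ⟨t0, rest⟩
    · simp
    · have hrest : rest = [] := by
        rw [hn] at ih
        exact List.eq_nil_of_length_eq_zero (by simp only [List.length_cons] at ih; omega)
      subst hrest
      simp only [List.flatMap_cons, List.flatMap_nil, List.append_nil, List.length_map]
      apply insL_length_le
      have ht0 : t0 ∈ nfWord w := by rw [hn]; exact List.mem_cons_self
      cases hd : ℓ.dag
      · right
        refine ⟨rfl, ?_⟩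
        rw [caWord_cons_false hd] at h
        exact allAnn_of_subset (nfWord_letters w t0 ht0) h
      · left
        exact ⟨rfl, nfWord_ca w t0 ht0⟩

theorem allAnn_map (f : Letter → Letter) (hf : ∀ ℓ, (f ℓ).dag = ℓ.dag) (w : Word) : allAnn (w.map f) = allAnn w := by
  induction w with
  | nil => rfl
  | cons ℓ w ih => rw [List.map_cons, allAnn_cons, allAnn_cons, hf, ih]

theorem caWord_map (f : Letter → Letter) (hf : ∀ ℓ, (f ℓ).dag = ℓ.dag) : ∀ (w : Word), caWord (w.map f) = caWord w
  | [] => rfl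
  | ℓ :: w => by
    rw [List.map_cons]
    cases hd : ℓ.dag
    · rw [caWord_cons_false hd, caWord_cons_false (by rw [hf, hd]), allAnn_map f hf]
    · rw [caWord_cons_true hd, caWord_cons_true (by rw [hf, hd]), caWord_map f hf w]

theorem caWord_moveWordF (γ : DihedralGroup 4) (v : Site 2) (u : Word) : caWord (moveWordF γ v u) = caWord u :=
  caWord_map (fun ℓ => (⟨flatSite (moveSite γ v ℓ.x), ℓ.s, ℓ.dag⟩ : Letter)) (fun _ => rfl) u

/-! ##### (g) Soundness of the anchored canonicaliser, one residual term at a time -/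

/-- Two at-most-one-term polynomials with the same lead word and opposite lead coefficients cancel. -/
theorem leadNegOf_sound {Λ' : Finset (Site 2)} :
    ∀ {p q : QPoly}, leadNegOf p q = true → p.length ≤ 1 → q.length ≤ 1 → polyOp Λ' p + polyOp Λ' q = 0
  | [], _, h, _, _ => by simp [leadNegOf] at h
  | _ :: _, [], h, _, _ => by simp [leadNegOf] at h
  | t :: p', t' :: q', h, hp, hq => by
    have hp' : p' = [] := List.eq_nil_of_length_eq_zero (by simp only [List.length_cons] at hp; omega)
    have hq' : q' = [] := List.eq_nil_of_length_eq_zero (by simp only [List.length_cons] at hq; omega)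
    subst hp' hq'
    simp only [leadNegOf, Bool.and_eq_true, decide_eq_true_eq] at h
    obtain ⟨⟨hw, hc⟩, -⟩ := h
    rw [polyOp_single, polyOp_single, (wordEq_iff _ _).1 hw, hc, Rat.cast_neg, neg_smul, add_neg_cancel]

/-- `anchoredNFs` with the move `(γ, v)` remembered. -/
def anchoredMoves (corner : Site 2) (frame : List (Site 2)) (u : Word) :
    List ((DihedralGroup 4 × Site 2) × QPoly) :=
  d4All.filterMap fun γ =>
    let v := flatSite (corner - minCorner (wordSites (moveWordF γ 0 u)))
    let w := moveWordF γ v u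
    if suppIn w frame then some ((γ, v), nfWord w) else none

theorem anchoredNFs_eq_map (corner : Site 2) (frame : List (Site 2)) (u : Word) :
    anchoredNFs corner frame u = (anchoredMoves corner frame u).map Prod.snd := by
  rw [anchoredMoves, List.map_filterMap]
  unfold anchoredNFs
  congr 1
  funext γ
  dsimp only
  split <;> rfl

theorem mem_anchoredMoves {corner : Site 2} {frame : List (Site 2)} {u : Word}
    {e : (DihedralGroup 4 × Site 2) × QPoly} (h : e ∈ anchoredMoves corner frame u) :
    e.2 = nfWord (moveWordF e.1.1 e.1.2 u) ∧ suppIn (moveWordF e.1.1 e.1.2 u) frame = true := by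
  simp only [anchoredMoves, List.mem_filterMap] at h
  obtain ⟨γ, -, hγ⟩ := h
  split_ifs at hγ with hs
  obtain rfl := Option.some.inj hγ
  exact ⟨rfl, hs⟩

/-- The `polyKeyLt`-selection of `canonA`, on candidates carrying their move. -/
def selBest {α : Type*} (e : α × QPoly) (es : List (α × QPoly)) : α × QPoly :=
  es.foldl (fun b c => if polyKeyLt c.2 b.2 then c else b) e

theorem selBest_cons {α : Type*} (e c : α × QPoly) (es : List (α × QPoly)) :
    selBest e (c :: es) = selBest (if polyKeyLt c.2 e.2 then c else e) es := rfl

theorem selBest_snd {α : Type*} : ∀ (es : List (α × QPoly)) (e : α × QPoly),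
    (selBest e es).2 = (es.map Prod.snd).foldl (fun b c => if polyKeyLt c b then c else b) e.2
  | [], _ => rfl
  | c :: es, e => by
    rw [selBest_cons, selBest_snd es, List.map_cons, List.foldl_cons]
    by_cases h : polyKeyLt c.2 e.2 = true
    · rw [if_pos h, if_pos h]
    · rw [if_neg h, if_neg h]

theorem selBest_mem {α : Type*} : ∀ (es : List (α × QPoly)) (e : α × QPoly), selBest e es ∈ e :: es
  | [], e => List.mem_singleton_self e
  | c :: es, e => by
    rw [selBest_cons]
    by_cases hc : polyKeyLt c.2 e.2 = true
    · rw [if_pos hc]; exact List.mem_cons_of_mem _ (selBest_mem es c)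
    · rw [if_neg hc]
      rcases List.mem_cons.1 (selBest_mem es e) with h | h
      · rw [h]; exact List.mem_cons_self
      · exact List.mem_cons_of_mem _ (List.mem_cons_of_mem _ h)

/-- One identification USE `z • (wordOp (γu+v) − wordOp u)` (the `tt`-family currency of `WardD4Identity`
with `Y := z • u`). -/
structure IdUse where
  z : ℚ
  u : Word
  γ : DihedralGroup 4
  v : Site 2

/-- The identification uses by which `canonTermA` replaces the term `t`: none (no anchored image fits),
one (`t ↦ best image`), or two halves (sign-odd word `↦ 0`). -/
def usesOfTerm (corner : Site 2) (frame : List (Site 2)) (t : ℚ × Word) : List IdUse :=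
  match anchoredMoves corner frame t.2 with
  | [] => []
  | e :: es =>
    match (e :: es).find? (fun c => leadNegOf (selBest e es).2 c.2) with
    | some c => [⟨-t.1 / 2, t.2, (selBest e es).1.1, (selBest e es).1.2⟩, ⟨-t.1 / 2, t.2, c.1.1, c.1.2⟩]
    | none => [⟨-t.1, t.2, (selBest e es).1.1, (selBest e es).1.2⟩]

theorem usesOfTerm_spec {corner : Site 2} {frame : List (Site 2)} {t : ℚ × Word} :
    ∀ e ∈ usesOfTerm corner frame t, e.u = t.2 ∧ ∃ c ∈ anchoredMoves corner frame t.2, c.1 = (e.γ, e.v) := by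
  intro e he
  unfold usesOfTerm at he
  split at he
  · simp at he
  · next e' es hA =>
    have hb : selBest e' es ∈ anchoredMoves corner frame t.2 := hA ▸ selBest_mem es e'
    split at he
    · next c hf =>
      have hc : c ∈ anchoredMoves corner frame t.2 := hA ▸ List.mem_of_find?_eq_some hf
      simp only [List.mem_cons, List.not_mem_nil, or_false] at he
      rcases he with rfl | rfl
      · exact ⟨rfl, _, hb, rfl⟩
      · exact ⟨rfl, _, hc, rfl⟩
    · simp only [List.mem_singleton] at he
      subst he
      exact ⟨rfl, _, hb, rfl⟩

theorem usesOfTerm_of_nil {corner : Site 2} {frame : List (Site 2)} {t : ℚ × Word}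
    (hA : anchoredMoves corner frame t.2 = []) : usesOfTerm corner frame t = [] := by
  unfold usesOfTerm; simp only [hA]

theorem usesOfTerm_of_none {corner : Site 2} {frame : List (Site 2)} {t : ℚ × Word}
    {e : (DihedralGroup 4 × Site 2) × QPoly} {es : List ((DihedralGroup 4 × Site 2) × QPoly)}
    (hA : anchoredMoves corner frame t.2 = e :: es)
    (hf : (e :: es).find? (fun c => leadNegOf (selBest e es).2 c.2) = none) :
    usesOfTerm corner frame t = [⟨-t.1, t.2, (selBest e es).1.1, (selBest e es).1.2⟩] := by
  unfold usesOfTerm; simp only [hA, hf]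

theorem usesOfTerm_of_some {corner : Site 2} {frame : List (Site 2)} {t : ℚ × Word}
    {e c : (DihedralGroup 4 × Site 2) × QPoly} {es : List ((DihedralGroup 4 × Site 2) × QPoly)}
    (hA : anchoredMoves corner frame t.2 = e :: es)
    (hf : (e :: es).find? (fun c => leadNegOf (selBest e es).2 c.2) = some c) :
    usesOfTerm corner frame t =
      [⟨-t.1 / 2, t.2, (selBest e es).1.1, (selBest e es).1.2⟩, ⟨-t.1 / 2, t.2, c.1.1, c.1.2⟩] := by
  unfold usesOfTerm; simp only [hA, hf]

/-- The operator of a use. -/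
def useOp (Λ' : Finset (Site 2)) (e : IdUse) : FermionOp Λ' :=
  ((e.z : ℚ) : ℂ) • (wordOp Λ' (moveWord e.γ e.v e.u) - wordOp Λ' e.u)

theorem polyOp_of_mem_anchored (h1 : NfFaithful) {Λ' : Finset (Site 2)} {corner : Site 2} {frame : List (Site 2)}
    {u : Word} (hfr : ∀ x ∈ frame, x ∈ Λ') {e : (DihedralGroup 4 × Site 2) × QPoly}
    (he : e ∈ anchoredMoves corner frame u) : polyOp Λ' e.2 = wordOp Λ' (moveWord e.1.1 e.1.2 u) := by
  obtain ⟨h2, hs⟩ := mem_anchoredMoves he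
  rw [h2, moveWordF_eq]
  rw [moveWordF_eq] at hs
  exact (h1 Λ' _ (fun ℓ hℓ => hfr _ ((suppIn_iff _ _).1 hs ℓ hℓ))).symm

theorem length_of_mem_anchored {corner : Site 2} {frame : List (Site 2)} {u : Word} (hu : caWord u = true)
    {e : (DihedralGroup 4 × Site 2) × QPoly} (he : e ∈ anchoredMoves corner frame u) : e.2.length ≤ 1 := by
  obtain ⟨h2, -⟩ := mem_anchoredMoves he
  rw [h2]
  exact nfWord_length_le _ (by rw [caWord_moveWordF]; exact hu)

/-- **Soundness of `canonTermA` on one residual term**: the canonical form differs from the term by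
identification uses, all moves of which fit the frame. -/
theorem canonTermA_sound (h1 : NfFaithful) {Λ' : Finset (Site 2)} (corner : Site 2) (frame : List (Site 2))
    (hfr : ∀ x ∈ frame, x ∈ Λ') (t : ℚ × Word) (hca : caWord t.2 = true) :
    ((t.1 : ℚ) : ℂ) • wordOp Λ' t.2 - polyOp Λ' (canonTermA corner frame t) =
      ((usesOfTerm corner frame t).map (useOp Λ')).sum := by
  unfold canonTermA canonA
  rw [anchoredNFs_eq_map]
  rcases hA : anchoredMoves corner frame t.2 with _ | ⟨e, es⟩
  · rw [usesOfTerm_of_nil hA]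
    simp only [List.map_nil, List.sum_nil]
    rw [polyOp_pscale, polyOp_single, Rat.cast_one, one_smul, sub_self]
  · have heA : ∀ c ∈ e :: es, c ∈ anchoredMoves corner frame t.2 := fun c hc => hA ▸ hc
    have hbest : selBest e es ∈ e :: es := selBest_mem es e
    have hfold : List.foldl (fun b c' => if polyKeyLt c' b then c' else b) e.2 (es.map Prod.snd) =
        (selBest e es).2 := (selBest_snd es e).symm
    have hany : ((e.2 :: es.map Prod.snd).any (leadNegOf (selBest e es).2)) =
        ((e :: es).any fun c => leadNegOf (selBest e es).2 c.2) := by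
      rw [← List.map_cons, List.any_map]; rfl
    simp only [List.map_cons, hfold, hany]
    rcases hf : (e :: es).find? (fun c => leadNegOf (selBest e es).2 c.2) with _ | c
    · have hnone : ((e :: es).any fun c => leadNegOf (selBest e es).2 c.2) = false :=
        List.any_eq_false.2 fun c hc => List.find?_eq_none.1 hf c hc
      rw [usesOfTerm_of_none hA hf]
      simp only [hnone, Bool.false_eq_true, if_false, List.map_cons, List.map_nil, List.sum_cons, List.sum_nil,
        add_zero, useOp]
      rw [polyOp_pscale, polyOp_of_mem_anchored h1 hfr (heA _ hbest)]
      push_cast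
      module
    · have hc : c ∈ e :: es := List.mem_of_find?_eq_some hf
      have hpc : leadNegOf (selBest e es).2 c.2 = true := by
        have h := List.find?_some hf
        simpa using h
      have hsome : ((e :: es).any fun c => leadNegOf (selBest e es).2 c.2) = true :=
        List.any_eq_true.2 ⟨c, hc, hpc⟩
      rw [usesOfTerm_of_some hA hf]
      simp only [hsome, if_true, List.map_cons, List.map_nil, List.sum_cons, List.sum_nil, add_zero, useOp]
      have hsum : wordOp Λ' (moveWord (selBest e es).1.1 (selBest e es).1.2 t.2) +
          wordOp Λ' (moveWord c.1.1 c.1.2 t.2) = 0 := by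
        rw [← polyOp_of_mem_anchored h1 hfr (heA _ hbest), ← polyOp_of_mem_anchored h1 hfr (heA _ hc)]
        exact leadNegOf_sound hpc (length_of_mem_anchored hca (heA _ hbest)) (length_of_mem_anchored hca (heA _ hc))
      rw [eq_neg_of_add_eq_zero_right hsum, polyOp_pscale, polyOp_nil, smul_zero, sub_zero]
      push_cast
      module


/-! ##### (h) Supports: every word the checker manipulates lives in the frame -/

/-- All words of a polynomial are supported in `Λ`. -/
def PSupp (p : QPoly) (Λ : Finset (Site 2)) : Prop := ∀ t ∈ p, SuppIn t.2 Λ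

theorem PSupp.append {p r : QPoly} {Λ : Finset (Site 2)} (hp : PSupp p Λ) (hr : PSupp r Λ) : PSupp (p ++ r) Λ :=
  fun t ht => (List.mem_append.1 ht).elim (hp t) (hr t)

theorem PSupp.pscale {p : QPoly} {Λ : Finset (Site 2)} (q : ℚ) (hp : PSupp p Λ) : PSupp (pscale q p) Λ := by
  intro t ht
  simp only [SymReplay.pscale, List.mem_map] at ht
  obtain ⟨s, hs, rfl⟩ := ht
  exact hp s hs

theorem PSupp.psub {p r : QPoly} {Λ : Finset (Site 2)} (hp : PSupp p Λ) (hr : PSupp r Λ) : PSupp (psub p r) Λ :=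
  hp.append (hr.pscale _)

theorem PSupp.pmul {p r : QPoly} {Λ : Finset (Site 2)} (hp : PSupp p Λ) (hr : PSupp r Λ) : PSupp (pmul p r) Λ := by
  intro t ht
  simp only [SymReplay.pmul, List.mem_flatMap, List.mem_map] at ht
  obtain ⟨s, hs, s', hs', rfl⟩ := ht
  exact SuppIn_append.2 ⟨hp s hs, hr s' hs'⟩

theorem PSupp.padj {p : QPoly} {Λ : Finset (Site 2)} (hp : PSupp p Λ) : PSupp (padj p) Λ := by
  intro t ht
  simp only [SymReplay.padj, List.mem_map] at ht
  obtain ⟨s, hs, rfl⟩ := ht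
  exact SuppIn_adjWord (hp s hs)

theorem PSupp.comm {p r : QPoly} {Λ : Finset (Site 2)} (hp : PSupp p Λ) (hr : PSupp r Λ) : PSupp (comm p r) Λ :=
  (hp.pmul hr).psub (hr.pmul hp)

theorem PSupp.flatMap {α : Type*} {Λ : Finset (Site 2)} (l : List α) (f : α → QPoly)
    (h : ∀ a ∈ l, PSupp (f a) Λ) : PSupp (l.flatMap f) Λ := by
  intro t ht
  rw [List.mem_flatMap] at ht
  obtain ⟨a, ha, ht⟩ := ht
  exact h a ha t ht

theorem PSupp.nfPoly {p : QPoly} {Λ : Finset (Site 2)} (hp : PSupp p Λ) : PSupp (nfPoly p) Λ := by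
  intro t ht
  simp only [SymReplay.nfPoly, List.mem_flatMap, SymReplay.pscale, List.mem_map] at ht
  obtain ⟨s, hs, t0, ht0, rfl⟩ := ht
  exact fun ℓ hℓ => hp s hs ℓ (nfWord_letters s.2 t0 ht0 hℓ)

theorem mem_mergeAdj : ∀ (p : QPoly), ∀ t ∈ mergeAdj p, ∃ s ∈ p, s.2 = t.2
  | [], t, ht => by simp [mergeAdj] at ht
  | t0 :: rest, t, ht => by
    rw [mergeAdj] at ht
    split at ht
    · next h =>
      simp only [List.mem_singleton] at ht
      exact ⟨t0, List.mem_cons_self, by rw [ht]⟩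
    · next t' rest' h =>
      have ih : ∀ s ∈ t' :: rest', ∃ s0 ∈ rest, s0.2 = s.2 := fun s hs => mem_mergeAdj rest s (h ▸ hs)
      split_ifs at ht with hw
      · rcases List.mem_cons.1 ht with h' | ht
        · exact ⟨t0, List.mem_cons_self, by rw [h']⟩
        · obtain ⟨s, hs, hs'⟩ := ih t (List.mem_cons_of_mem _ ht)
          exact ⟨s, List.mem_cons_of_mem _ hs, hs'⟩
      · rcases List.mem_cons.1 ht with h' | ht
        · exact ⟨t0, List.mem_cons_self, by rw [h']⟩
        · obtain ⟨s, hs, hs'⟩ := ih t ht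
          exact ⟨s, List.mem_cons_of_mem _ hs, hs'⟩

theorem mem_collect (p : QPoly) (t : ℚ × Word) (ht : t ∈ collect p) : ∃ s ∈ p, s.2 = t.2 := by
  obtain ⟨s, hs, hs'⟩ := mem_mergeAdj (sortW p) t ht
  exact ⟨s, (sortW_perm p).mem_iff.1 hs, hs'⟩

theorem PSupp.collect {p : QPoly} {Λ : Finset (Site 2)} (hp : PSupp p Λ) : PSupp (collect p) Λ := fun t ht => by
  obtain ⟨s, hs, hs'⟩ := mem_collect p t ht
  rw [← hs']
  exact hp s hs

theorem collect_nfPoly_ca (p : QPoly) : ∀ t ∈ collect (nfPoly p), caWord t.2 = true := fun t ht => by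
  obtain ⟨s, hs, hs'⟩ := mem_collect _ t ht
  rw [← hs']
  simp only [nfPoly, List.mem_flatMap, pscale, List.mem_map] at hs
  obtain ⟨s0, -, t0, ht0, rfl⟩ := hs
  exact nfWord_ca s0.2 t0 ht0

theorem PSupp_of_psuppIn {p : QPoly} {S : List (Site 2)} (h : psuppIn p S = true) : PSupp p S.toFinset :=
  fun t ht => SuppIn_of_suppIn ((psuppIn_iff p S).1 h t ht)

theorem PSupp.mono {p : QPoly} {Λ Λ' : Finset (Site 2)} (h : Λ ⊆ Λ') (hp : PSupp p Λ) : PSupp p Λ' :=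
  fun t ht => (hp t ht).mono h

theorem SuppIn_nil (Λ : Finset (Site 2)) : SuppIn [] Λ := fun ℓ hℓ => absurd hℓ (by simp)

theorem SuppIn_cons {ℓ : Letter} {w : Word} {Λ : Finset (Site 2)} : SuppIn (ℓ :: w) Λ ↔ ℓ.x ∈ Λ ∧ SuppIn w Λ := by
  simp only [SuppIn, List.mem_cons, forall_eq_or_imp]

theorem PSupp_single {q : ℚ} {w : Word} {Λ : Finset (Site 2)} (hw : SuppIn w Λ) : PSupp [(q, w)] Λ := by
  intro t ht
  simp only [List.mem_singleton] at ht
  subst ht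
  exact hw

theorem PSupp_hop {q : ℚ} {x y : Site 2} {Λ : Finset (Site 2)} (hx : x ∈ Λ) (hy : y ∈ Λ) : PSupp (hop q x y) Λ := by
  intro t ht
  simp only [hop, List.mem_flatMap, List.mem_cons, List.not_mem_nil, or_false] at ht
  obtain ⟨σ, -, rfl | rfl⟩ := ht
  · exact SuppIn_cons.2 ⟨hx, SuppIn_cons.2 ⟨hy, SuppIn_nil _⟩⟩
  · exact SuppIn_cons.2 ⟨hy, SuppIn_cons.2 ⟨hx, SuppIn_nil _⟩⟩

theorem PSupp_onsite {q : ℚ} {x : Site 2} {Λ : Finset (Site 2)} (hx : x ∈ Λ) : PSupp (onsite q x) Λ :=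
  PSupp_single (SuppIn_cons.2 ⟨hx, SuppIn_cons.2 ⟨hx, SuppIn_cons.2 ⟨hx, SuppIn_cons.2 ⟨hx, SuppIn_nil _⟩⟩⟩⟩)

theorem PSupp_hamPoly (frame : List (Site 2)) : PSupp (hamPoly frame) frame.toFinset := by
  refine PSupp.append (PSupp.flatMap _ _ fun x hx => PSupp_onsite (List.mem_toFinset.2 hx))
    (PSupp.flatMap _ _ fun x hx => PSupp.flatMap _ _ fun y hy => ?_)
  split_ifs
  · exact PSupp_hop (List.mem_toFinset.2 hx) (List.mem_toFinset.2 hy)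
  · intro t ht; simp at ht

theorem PSupp_energyPoly {Λ : Finset (Site 2)} (h0 : thicken ({0} : Finset (Site 2)) 1 ⊆ Λ) : PSupp energyPoly Λ := by
  have hz : (0 : Site 2) ∈ Λ := h0 (zero_mem_thicken_zero 1)
  have he1 : e1 ∈ Λ := h0 (unitVec_zero_eq_e1 ▸ unitVec_mem_thicken_one 0)
  have he2 : e2 ∈ Λ := h0 (unitVec_one_eq_e2 ▸ unitVec_mem_thicken_one 1)
  have hne1 : -e1 ∈ Λ := h0 (unitVec_zero_eq_e1 ▸ neg_unitVec_mem_thicken_one 0)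
  have hne2 : -e2 ∈ Λ := h0 (unitVec_one_eq_e2 ▸ neg_unitVec_mem_thicken_one 1)
  exact ((((PSupp_onsite hz).append (PSupp_hop hz he1)).append (PSupp_hop hz he2)).append
    (PSupp_hop hne1 hz)).append (PSupp_hop hne2 hz)

theorem PSupp_densPoly {Λ : Finset (Site 2)} (hz : (0 : Site 2) ∈ Λ) (σ : Fin 2) : PSupp (densPoly σ) Λ :=
  PSupp_single (SuppIn_cons.2 ⟨hz, SuppIn_cons.2 ⟨hz, SuppIn_nil _⟩⟩)

theorem PSupp_spinPlusPoly (frame : List (Site 2)) : PSupp (spinPlusPoly frame) frame.toFinset := by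
  intro t ht
  simp only [spinPlusPoly, List.mem_map] at ht
  obtain ⟨x, hx, rfl⟩ := ht
  exact SuppIn_cons.2 ⟨List.mem_toFinset.2 hx, SuppIn_cons.2 ⟨List.mem_toFinset.2 hx, SuppIn_nil _⟩⟩

theorem PSupp_spinMinusPoly (frame : List (Site 2)) : PSupp (spinMinusPoly frame) frame.toFinset := by
  intro t ht
  simp only [spinMinusPoly, List.mem_map] at ht
  obtain ⟨x, hx, rfl⟩ := ht
  exact SuppIn_cons.2 ⟨List.mem_toFinset.2 hx, SuppIn_cons.2 ⟨List.mem_toFinset.2 hx, SuppIn_nil _⟩⟩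

theorem PSupp_lhsPoly (K : SymCert) {Λ : Finset (Site 2)} (h0 : thicken ({0} : Finset (Site 2)) 1 ⊆ Λ) :
    PSupp (lhsPoly K) Λ :=
  have hz : (0 : Site 2) ∈ Λ := h0 (zero_mem_thicken_zero 1)
  ((PSupp_energyPoly h0).append (PSupp_single (SuppIn_nil _))).append
    ((((PSupp_densPoly hz 0).append (PSupp_densPoly hz 1)).append (PSupp_single (SuppIn_nil _))).pscale _)

/-- The right-hand side polynomial is supported in the frame (from the `wellFormed` clauses). -/
theorem PSupp_rhsPoly (K : SymCert)
    (hg : ∀ g ∈ K.gram, psuppIn g.2 K.frame = true) (he : ∀ B ∈ K.eom, psuppIn B K.inner = true)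
    (hIF : subSites K.inner K.frame = true)
    (hm : ∀ mv ∈ K.moves, suppIn mv.u K.frame = true ∧ suppIn (moveWordF mv.γ mv.v mv.u) K.frame = true)
    (hc : ∀ t ∈ K.charged, suppIn t.2 K.frame = true) (hp : ∀ X ∈ K.wardP, psuppIn X K.frame = true)
    (hm' : ∀ X ∈ K.wardM, psuppIn X K.frame = true) (ha : ∀ t ∈ K.antiH, psuppIn t.2 K.frame = true)
    (hs : ∀ t ∈ K.slack, suppIn t.2 K.frame = true) :
    PSupp (rhsPoly K) K.frame.toFinset := by
  have hIF' : K.inner.toFinset ⊆ K.frame.toFinset := fun x hx =>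
    List.mem_toFinset.2 ((subSites_iff _ _).1 hIF x (List.mem_toFinset.1 hx))
  refine PSupp.append ?_ (fun t ht => SuppIn_of_suppIn (hs t ht))
  refine PSupp.append ?_ (PSupp.flatMap _ _ fun t ht => ((PSupp_of_psuppIn (ha t ht)).padj.psub
    (PSupp_of_psuppIn (ha t ht))).pscale _)
  refine PSupp.append ?_ (PSupp.flatMap _ _ fun X hX =>
    (PSupp_spinMinusPoly K.frame).comm (PSupp_of_psuppIn (hm' X hX)))
  refine PSupp.append ?_ (PSupp.flatMap _ _ fun X hX =>
    (PSupp_spinPlusPoly K.frame).comm (PSupp_of_psuppIn (hp X hX)))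
  refine PSupp.append ?_ (fun t ht => SuppIn_of_suppIn (hc t ht))
  refine PSupp.append ?_ (PSupp.flatMap _ _ fun mv hmv => ?_)
  · refine PSupp.append ?_ (PSupp.flatMap _ _ fun B hB => (PSupp_hamPoly K.frame).comm
      ((PSupp_of_psuppIn (he B hB)).mono hIF'))
    exact PSupp.flatMap _ _ fun g hg' => ((PSupp_of_psuppIn (hg g hg')).padj.pmul
      (PSupp_of_psuppIn (hg g hg'))).pscale _
  · intro t ht
    simp only [List.mem_cons, List.not_mem_nil, or_false] at ht
    rcases ht with rfl | rfl
    · rw [← moveWordF_eq]; exact SuppIn_of_suppIn (hm mv hmv).2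
    · exact SuppIn_of_suppIn (hm mv hmv).1

/-! ##### (i) The residual and its identification expansion; the enlarged frame `Λ'⁺` -/

/-- The collected normal form of `LHS − RHS` (what `identityOK` canonicalises and tests). -/
def residual (K : SymCert) : QPoly := collect (nfPoly (psub (lhsPoly K) (rhsPoly K)))

/-- The identification uses spent by the canonicaliser on the residual (none when `useCanon = false`). -/
def canonUses (K : SymCert) : List IdUse :=
  if K.useCanon then (residual K).flatMap (usesOfTerm (flatSite (minCorner K.frame)) K.frame) else []

/-- All identification uses of the certificate: explicit `moves` hints, then the canonicaliser's. -/
def ttList (K : SymCert) : List IdUse :=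
  (K.moves.map fun mv => (⟨mv.z, mv.u, mv.γ, mv.v⟩ : IdUse)) ++ canonUses K

/-- **The enlarged frame `Λ'⁺`**: the king-move thickening of the frame together with every affine-`D₄`
image of the frame under a used move — so that each per-word licensed move is licensed for `Λ := frame`. -/
def bigFrame (K : SymCert) : Finset (Site 2) :=
  thicken K.frame.toFinset 1 ∪ (ttList K).foldr (fun e S => d4ShiftSet e.γ e.v K.frame.toFinset ∪ S) ∅

theorem subset_foldr_d4ShiftSet (F : Finset (Site 2)) :
    ∀ (l : List IdUse), ∀ e ∈ l, d4ShiftSet e.γ e.v F ⊆ l.foldr (fun e S => d4ShiftSet e.γ e.v F ∪ S) ∅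
  | [], e, he => absurd he (by simp)
  | e' :: l, e, he => by
    rw [List.foldr_cons]
    rcases List.mem_cons.1 he with rfl | he
    · exact Finset.subset_union_left
    · exact (subset_foldr_d4ShiftSet F l e he).trans Finset.subset_union_right

theorem d4ShiftSet_subset_bigFrame (K : SymCert) {e : IdUse} (he : e ∈ ttList K) :
    d4ShiftSet e.γ e.v K.frame.toFinset ⊆ bigFrame K :=
  (subset_foldr_d4ShiftSet _ _ e he).trans Finset.subset_union_right

theorem thicken_subset_bigFrame (K : SymCert) : thicken K.frame.toFinset 1 ⊆ bigFrame K :=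
  Finset.subset_union_left

theorem sum_canonTerm (h1 : NfFaithful) {Λ' : Finset (Site 2)} (corner : Site 2) (frame : List (Site 2))
    (hfr : ∀ x ∈ frame, x ∈ Λ') :
    ∀ (N : QPoly), (∀ t ∈ N, caWord t.2 = true) →
      polyOp Λ' N - polyOp Λ' (N.flatMap (canonTermA corner frame)) =
        ((N.flatMap (usesOfTerm corner frame)).map (useOp Λ')).sum
  | [], _ => by simp
  | t :: N, h => by
    rw [List.flatMap_cons, List.flatMap_cons, polyOp_append, polyOp_cons, List.map_append, List.sum_append,
      ← sum_canonTerm h1 corner frame hfr N (fun s hs => h s (List.mem_cons_of_mem _ hs)),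
      ← canonTermA_sound h1 corner frame hfr t (h t List.mem_cons_self)]
    abel

/-- **The residual equation**: `identityOK` ⇒ `LHS − RHS = Σ (canonical identification uses)` in `𝔄_{Λ'}`
for every `Λ'` containing the frame. -/
theorem residual_expansion (h1 : NfFaithful) (K : SymCert) {Λ' : Finset (Site 2)}
    (hfr : ∀ x ∈ K.frame, x ∈ Λ') (hsupp : PSupp (psub (lhsPoly K) (rhsPoly K)) Λ') (hid : identityOK K = true) :
    polyOp Λ' (lhsPoly K) - polyOp Λ' (rhsPoly K) = ((canonUses K).map (useOp Λ')).sum := by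
  have hres : polyOp Λ' (residual K) = polyOp Λ' (lhsPoly K) - polyOp Λ' (rhsPoly K) := by
    rw [residual, polyOp_eq_evalP, collect_eval, ← polyOp_eq_evalP, polyOp_nfPoly h1 _ _ hsupp, polyOp_psub]
  change isZero (if K.useCanon then (residual K).flatMap (canonTermA (flatSite (minCorner K.frame)) K.frame)
    else residual K) = true at hid
  rw [← hres, canonUses]
  cases hc : K.useCanon
  · simp only [hc, Bool.false_eq_true, if_false] at hid ⊢
    rw [List.map_nil, List.sum_nil]
    exact polyOp_eq_zero_of_isZero Λ' _ hid
  · simp only [hc, if_true] at hid ⊢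
    rw [← sum_canonTerm h1 _ _ hfr (residual K) (collect_nfPoly_ca _), polyOp_eq_zero_of_isZero Λ' _ hid, sub_zero]


theorem ttList_supp (K : SymCert)
    (hmov : ∀ mv ∈ K.moves, suppIn mv.u K.frame = true ∧ suppIn (moveWordF mv.γ mv.v mv.u) K.frame = true)
    (hres : PSupp (residual K) K.frame.toFinset) : ∀ e ∈ ttList K, SuppIn e.u K.frame.toFinset := by
  intro e he
  rw [ttList, List.mem_append] at he
  rcases he with he | he
  · rw [List.mem_map] at he
    obtain ⟨mv, hmv, rfl⟩ := he
    exact SuppIn_of_suppIn (hmov mv hmv).1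
  · rw [canonUses] at he
    split_ifs at he with hc
    · rw [List.mem_flatMap] at he
      obtain ⟨t, ht, he⟩ := he
      rw [(usesOfTerm_spec e he).1]
      exact hres t ht
    · simp at he


end S4Sound


/-- **S4 (L).**  Given the three algebra kernels S1–S3, the checker is sound: unfold `symCheck`; read the lists
as `Fin`-indexed families (`List.get`); `Λ := K.inner.toFinset`, `Λ' := K.frame.toFinset` (side conditions
from `wellFormed` via `List.mem_toFinset`; `thick`/`nbhd` = `thicken · 1`); Gram part = `gramForm (diagonal d) O`
with `O k := polyOp (q_k)` (`posSemidef_diagonal_iff`, `polyOp (padj q) = (polyOp q)ᴴ`, `polyOp (pmul p r) =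
polyOp p * polyOp r`); `canonA`/`moves` terms ↦ the family `tt` by S2 with `Λ := supp u` (+ S1 for `nfWord` of the moved word);
charged words ↦ `u, b` (`wordCharge = ladderCharge`, `wordSpinCharge = ladderSpinCharge` letterwise);
`isZero ∘ collect ∘ nfPoly = true` ⇒ the operator identity by S1 and linearity; value `c − Σ|a_k|` with
`‖(a : ℂ)‖ = |a|`. -/
theorem stub_soundOfKernels : NfFaithful → MoveSound → DictionarySound → SymCheckSound := by
  intro h1 _ h3 K hK
  /- (0) unpack the checker's verdict -/
  have hK' := hK
  rw [symCheck, Bool.and_eq_true] at hK'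
  obtain ⟨hwf, hid⟩ := hK'
  simp only [wellFormed, Bool.and_eq_true] at hwf
  obtain ⟨⟨⟨⟨⟨⟨⟨⟨⟨⟨⟨⟨hnd, hz0⟩, hn0⟩, hIF⟩, hth⟩, hgram⟩, heom⟩, hmov⟩, hch⟩, hwp⟩, hwm⟩, hah⟩, hsl⟩ := hwf
  have hgram' : ∀ g ∈ K.gram, 0 ≤ g.1 ∧ psuppIn g.2 K.frame = true := fun g hg => by
    have h := List.all_eq_true.1 hgram g hg
    rw [Bool.and_eq_true, decide_eq_true_eq] at h
    exact h
  have heom' : ∀ B ∈ K.eom, psuppIn B K.inner = true := fun B hB => List.all_eq_true.1 heom B hB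
  have hmov' : ∀ mv ∈ K.moves, suppIn mv.u K.frame = true ∧ suppIn (moveWordF mv.γ mv.v mv.u) K.frame = true :=
    fun mv hmv => by
      have h := List.all_eq_true.1 hmov mv hmv
      rwa [Bool.and_eq_true] at h
  have hch' : ∀ t ∈ K.charged, suppIn t.2 K.frame = true ∧ (wordCharge t.2 ≠ 0 ∨ wordSpinCharge t.2 ≠ 0) :=
    fun t ht => by
      have h := List.all_eq_true.1 hch t ht
      rw [Bool.and_eq_true, Bool.or_eq_true] at h
      exact ⟨h.1, h.2.imp bne_iff_ne.1 bne_iff_ne.1⟩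
  have hwp' : ∀ X ∈ K.wardP, psuppIn X K.frame = true := fun X hX => List.all_eq_true.1 hwp X hX
  have hwm' : ∀ X ∈ K.wardM, psuppIn X K.frame = true := fun X hX => List.all_eq_true.1 hwm X hX
  have hah' : ∀ t ∈ K.antiH, psuppIn t.2 K.frame = true := fun t ht => List.all_eq_true.1 hah t ht
  have hsl' : ∀ t ∈ K.slack, suppIn t.2 K.frame = true := fun t ht => List.all_eq_true.1 hsl t ht
  /- (1) the frame `F`, the inner window `I ⊆ F`, the enlarged frame `Λ'⁺ = (bigFrame K).toList.toFinset` -/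
  have hIF' : K.inner.toFinset ⊆ K.frame.toFinset := fun x hx =>
    List.mem_toFinset.2 ((subSites_iff _ _).1 hIF x (List.mem_toFinset.1 hx))
  have hthF : thicken K.inner.toFinset 1 ⊆ K.frame.toFinset := thicken_subset_of_thick hth
  have h0F : thicken ({0} : Finset (Site 2)) 1 ⊆ K.frame.toFinset := by
    have h : subSites (thick [0]) K.frame = true := by simpa [thick] using hn0
    have h' := thicken_subset_of_thick h
    simpa using h'
  have hzF : (0 : Site 2) ∈ K.frame.toFinset := List.mem_toFinset.2 ((memSite_iff _ _).1 hz0)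
  have hL : (bigFrame K).toList.toFinset = bigFrame K := Finset.toList_toFinset _
  have hFL : K.frame.toFinset ⊆ (bigFrame K).toList.toFinset := by
    rw [hL]; exact (subset_thicken _ 1).trans (thicken_subset_bigFrame K)
  have h8 : thicken K.frame.toFinset 1 ⊆ (bigFrame K).toList.toFinset := by
    rw [hL]; exact thicken_subset_bigFrame K
  have h0 : thicken ({0} : Finset (Site 2)) 1 ⊆ (bigFrame K).toList.toFinset := h0F.trans hFL
  have hz : (0 : Site 2) ∈ (bigFrame K).toList.toFinset := hFL hzF
  have hfr : ∀ x ∈ K.frame, x ∈ (bigFrame K).toList.toFinset := fun x hx => hFL (List.mem_toFinset.2 hx)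
  have hndL : nodupSites (bigFrame K).toList = true := nodupSites_of_nodup _ (Finset.nodup_toList _)
  have hshf : ∀ l : Fin (ttList K).length,
      d4ShiftSet ((ttList K).get l).γ ((ttList K).get l).v K.frame.toFinset ⊆ (bigFrame K).toList.toFinset :=
    fun l => by rw [hL]; exact d4ShiftSet_subset_bigFrame K (List.get_mem _ l)
  /- (2) the dictionary (S3) in `F` and in `Λ'⁺`; supports; the residual equation -/
  obtain ⟨hHF, -, -, hSpF, hSmF⟩ := h3 K.frame hnd
  obtain ⟨-, hEL, hDL, -, -⟩ := h3 (bigFrame K).toList hndL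
  have hsR : PSupp (rhsPoly K) K.frame.toFinset := PSupp_rhsPoly K (fun g hg => (hgram' g hg).2) heom' hIF hmov'
    (fun t ht => (hch' t ht).1) hwp' hwm' hah' hsl'
  have hsL : PSupp (lhsPoly K) K.frame.toFinset := PSupp_lhsPoly K h0F
  have htt : ∀ e ∈ ttList K, SuppIn e.u K.frame.toFinset :=
    ttList_supp K hmov' (hsL.psub hsR).nfPoly.collect
  have hR := residual_expansion h1 K hfr ((hsL.psub hsR).mono hFL) hid
  /- (3) the witness -/
  refine ⟨K.frame.toFinset, (bigFrame K).toList.toFinset, hFL, h8, h0, hz, (K.mu : ℝ),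
    K.gram.length, Matrix.diagonal (fun k => (((K.gram.get k).1 : ℚ) : ℂ)), ?_,
    fun k => polyOp (bigFrame K).toList.toFinset (K.gram.get k).2,
    K.eom.length, fun k => polyOp K.frame.toFinset (K.eom.get k),
    (ttList K).length, fun l => ((ttList K).get l).γ, fun l => ((ttList K).get l).v, hshf,
    fun l => ((((ttList K).get l).z : ℚ) : ℂ) • wordOp K.frame.toFinset ((ttList K).get l).u,
    K.charged.length, fun j => (((K.charged.get j).1 : ℚ) : ℂ),
    fun j => orbWord (bigFrame K).toList.toFinset hz (K.charged.get j).2, ?_,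
    K.wardP.length, fun r => polyOp (bigFrame K).toList.toFinset (K.wardP.get r),
    K.wardM.length, fun r => polyOp (bigFrame K).toList.toFinset (K.wardM.get r),
    K.antiH.length, fun m => (((K.antiH.get m).1 : ℚ) : ℝ),
    fun m => polyOp (bigFrame K).toList.toFinset (K.antiH.get m).2,
    K.slack.length, fun k => (((K.slack.get k).1 : ℚ) : ℂ),
    fun k => orbWord (bigFrame K).toList.toFinset hz (K.slack.get k).2,
    (K.c : ℝ), ?_, ?_⟩
  · /- the SOS weights are a PSD diagonal -/
    refine Matrix.posSemidef_diagonal_iff.2 fun k => ?_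
    rw [← Complex.ofReal_ratCast]
    exact Complex.zero_le_real.2 (by exact_mod_cast (hgram' _ (List.get_mem _ k)).1)
  · /- charged words carry a charge -/
    intro j _
    rw [ladderCharge_orbWord, ladderSpinCharge_orbWord]
    exact (hch' _ (List.get_mem _ j)).2
  · /- THE IDENTITY in `𝔄_{Λ'⁺}` -/
    unfold WardD4Identity
    dsimp only
    -- left-hand side
    have hLHS : polyOp (bigFrame K).toList.toFinset (lhsPoly K) =
        fermionEmbed (PolySite.incl h0) ((hubbardTTPrimeFermionInteraction 1 0 8).meanEnergyObs 1) -
          ((K.c : ℝ) : ℂ) • (1 : FermionOp (bigFrame K).toList.toFinset) -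
          (((K.mu : ℝ) : ℝ) : ℂ) • (nAt 0 hz 0 + nAt 0 hz 1 -
            (((7 / 8 : ℝ) : ℝ) : ℂ) • (1 : FermionOp (bigFrame K).toList.toFinset)) := by
      rw [lhsPoly, polyOp_append, polyOp_append, polyOp_pscale, polyOp_append, polyOp_append, hEL h0, hDL hz 0,
        hDL hz 1, polyOp_single, polyOp_single, wordOp_nil]
      push_cast
      module
    -- Gram part
    have hG : polyOp (bigFrame K).toList.toFinset (K.gram.flatMap fun g => pscale g.1 (pmul (padj g.2) g.2)) =
        gramForm (Matrix.diagonal (fun k => (((K.gram.get k).1 : ℚ) : ℂ)))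
          (fun k => polyOp (bigFrame K).toList.toFinset (K.gram.get k).2) := by
      rw [gramForm_diagonal_fin, polyOp_flatMap, ← sum_fin_get]
      refine Finset.sum_congr rfl fun k _ => ?_
      rw [polyOp_pscale, polyOp_pmul, polyOp_padj]
    -- EOM part
    have hE : polyOp (bigFrame K).toList.toFinset (K.eom.flatMap fun B => comm (hamPoly K.frame) B) =
        ∑ k : Fin K.eom.length,
          ((hubbardTTPrimeFermionInteraction 1 0 8).localHamiltonian (bigFrame K).toList.toFinset *
              fermionEmbed (PolySite.incl hFL) (polyOp K.frame.toFinset (K.eom.get k)) -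
            fermionEmbed (PolySite.incl hFL) (polyOp K.frame.toFinset (K.eom.get k)) *
              (hubbardTTPrimeFermionInteraction 1 0 8).localHamiltonian (bigFrame K).toList.toFinset) := by
      rw [polyOp_flatMap, ← sum_fin_get]
      refine Finset.sum_congr rfl fun k _ => ?_
      have hB : PSupp (K.eom.get k) K.inner.toFinset := PSupp_of_psuppIn (heom' _ (List.get_mem _ k))
      rw [polyOp_comm, polyOp_incl hFL (hamPoly K.frame) (PSupp_hamPoly K.frame), hHF, polyOp_incl hFL _ (hB.mono hIF'),
        polyOp_incl hIF' _ hB, ← map_mul, ← map_mul, ← map_sub, ← ham_commutator_transfer hIF' hthF hFL]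
    -- explicit moves
    have hMv : polyOp (bigFrame K).toList.toFinset
          (K.moves.flatMap fun mv => [(mv.z, moveWord mv.γ mv.v mv.u), (-mv.z, mv.u)]) =
        ((K.moves.map fun mv => (⟨mv.z, mv.u, mv.γ, mv.v⟩ : IdUse)).map (useOp (bigFrame K).toList.toFinset)).sum := by
      rw [polyOp_flatMap, List.map_map]
      congr 1
      refine List.map_congr_left fun mv _ => ?_
      simp only [Function.comp, useOp, polyOp_cons, polyOp_nil, add_zero]
      push_cast
      module
    -- the identification family
    have hT : ∑ l : Fin (ttList K).length,
        (fermionEmbed (PolySite.incl (hshf l))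
            (fermionEmbed (PolySite.d4Emb ((ttList K).get l).γ ((ttList K).get l).v K.frame.toFinset)
              (((((ttList K).get l).z : ℚ) : ℂ) • wordOp K.frame.toFinset ((ttList K).get l).u)) -
          fermionEmbed (PolySite.incl hFL)
            (((((ttList K).get l).z : ℚ) : ℂ) • wordOp K.frame.toFinset ((ttList K).get l).u)) =
        ((ttList K).map (useOp (bigFrame K).toList.toFinset)).sum := by
      rw [← sum_fin_get]
      refine Finset.sum_congr rfl fun l _ => ?_
      have hu : SuppIn ((ttList K).get l).u K.frame.toFinset := htt _ (List.get_mem _ l)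
      rw [map_smul, map_smul, map_smul, ← wordOp_moveWord (hshf l) _ hu, ← wordOp_incl hFL _ hu, useOp, smul_sub]
    -- charged words
    have hC : polyOp (bigFrame K).toList.toFinset K.charged =
        ∑ j : Fin K.charged.length, (((K.charged.get j).1 : ℚ) : ℂ) •
          ladderWord (orbWord (bigFrame K).toList.toFinset hz (K.charged.get j).2) := by
      rw [polyOp, ← sum_fin_get]
      refine Finset.sum_congr rfl fun j _ => ?_
      rw [ladderWord_orbWord _ _ _ ((SuppIn_of_suppIn (hch' _ (List.get_mem _ j)).1).mono hFL)]
    -- Ward families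
    have hP : polyOp (bigFrame K).toList.toFinset (K.wardP.flatMap fun X => comm (spinPlusPoly K.frame) X) =
        ∑ r : Fin K.wardP.length,
          ((spinPlus : FermionOp (bigFrame K).toList.toFinset) * polyOp (bigFrame K).toList.toFinset (K.wardP.get r) -
            polyOp (bigFrame K).toList.toFinset (K.wardP.get r) * spinPlus) := by
      rw [polyOp_flatMap, ← sum_fin_get]
      refine Finset.sum_congr rfl fun r _ => ?_
      have hX : PSupp (K.wardP.get r) K.frame.toFinset := PSupp_of_psuppIn (hwp' _ (List.get_mem _ r))
      rw [polyOp_comm, polyOp_incl hFL (spinPlusPoly K.frame) (PSupp_spinPlusPoly K.frame), hSpF, polyOp_incl hFL _ hX,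
        ← map_mul, ← map_mul, ← map_sub, ← spinPlus_commutator_transfer hFL]
    have hPm : polyOp (bigFrame K).toList.toFinset (K.wardM.flatMap fun X => comm (spinMinusPoly K.frame) X) =
        ∑ r : Fin K.wardM.length,
          ((spinMinus : FermionOp (bigFrame K).toList.toFinset) * polyOp (bigFrame K).toList.toFinset (K.wardM.get r) -
            polyOp (bigFrame K).toList.toFinset (K.wardM.get r) * spinMinus) := by
      rw [polyOp_flatMap, ← sum_fin_get]
      refine Finset.sum_congr rfl fun r _ => ?_
      have hX : PSupp (K.wardM.get r) K.frame.toFinset := PSupp_of_psuppIn (hwm' _ (List.get_mem _ r))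
      rw [polyOp_comm, polyOp_incl hFL (spinMinusPoly K.frame) (PSupp_spinMinusPoly K.frame), hSmF,
        polyOp_incl hFL _ hX, ← map_mul, ← map_mul, ← map_sub, ← spinMinus_commutator_transfer hFL]
    -- anti-Hermitian parts
    have hA : polyOp (bigFrame K).toList.toFinset (K.antiH.flatMap fun t => pscale t.1 (psub (padj t.2) t.2)) =
        ∑ m : Fin K.antiH.length, ((((K.antiH.get m).1 : ℚ) : ℝ) : ℂ) •
          ((polyOp (bigFrame K).toList.toFinset (K.antiH.get m).2)ᴴ -
            polyOp (bigFrame K).toList.toFinset (K.antiH.get m).2) := by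
      rw [polyOp_flatMap, ← sum_fin_get]
      refine Finset.sum_congr rfl fun m _ => ?_
      rw [polyOp_pscale, polyOp_psub, polyOp_padj, Complex.ofReal_ratCast]
    -- slack words
    have hS : polyOp (bigFrame K).toList.toFinset K.slack =
        ∑ k : Fin K.slack.length, (((K.slack.get k).1 : ℚ) : ℂ) •
          ladderWord (orbWord (bigFrame K).toList.toFinset hz (K.slack.get k).2) := by
      rw [polyOp, ← sum_fin_get]
      refine Finset.sum_congr rfl fun k _ => ?_
      rw [ladderWord_orbWord _ _ _ ((SuppIn_of_suppIn (hsl' _ (List.get_mem _ k))).mono hFL)]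
    -- the right-hand side, family by family
    have hRHS : polyOp (bigFrame K).toList.toFinset (rhsPoly K) =
        polyOp (bigFrame K).toList.toFinset (K.gram.flatMap fun g => pscale g.1 (pmul (padj g.2) g.2)) +
        polyOp (bigFrame K).toList.toFinset (K.eom.flatMap fun B => comm (hamPoly K.frame) B) +
        polyOp (bigFrame K).toList.toFinset
          (K.moves.flatMap fun mv => [(mv.z, moveWord mv.γ mv.v mv.u), (-mv.z, mv.u)]) +
        polyOp (bigFrame K).toList.toFinset K.charged +
        polyOp (bigFrame K).toList.toFinset (K.wardP.flatMap fun X => comm (spinPlusPoly K.frame) X) +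
        polyOp (bigFrame K).toList.toFinset (K.wardM.flatMap fun X => comm (spinMinusPoly K.frame) X) +
        polyOp (bigFrame K).toList.toFinset (K.antiH.flatMap fun t => pscale t.1 (psub (padj t.2) t.2)) +
        polyOp (bigFrame K).toList.toFinset K.slack := by
      simp only [rhsPoly, polyOp_append]
    -- assemble
    have key : polyOp (bigFrame K).toList.toFinset (lhsPoly K) =
        polyOp (bigFrame K).toList.toFinset (rhsPoly K) +
          ((canonUses K).map (useOp (bigFrame K).toList.toFinset)).sum := by
      rw [← hR]; abel
    conv at hT => rhs; rw [ttList, List.map_append, List.sum_append]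
    have hCn := eq_sub_of_add_eq' hT.symm
    rw [← hLHS, key, hRHS, hG, hE, hMv, hC, hP, hPm, hA, hS, hCn]
    abel
  · /- the value -/
    dsimp only
    simp only [norm_ratCast_complex]
    rw [← Rat.cast_sum, sum_fin_get K.slack (fun t => |t.1|)]
    have hv : symValue K = K.c - (K.slack.map fun t => |t.1|).sum := by
      simp only [symValue, qabs_eq_abs]
    rw [hv]
    push_cast
    exact le_rfl

/-- **S5 (XL — the computational crux in word form; DATA).**  A syntactic certificate passing `symCheck` with
value `≥ −83/100` exists.  Status by value: CERTIFIED #529 (MENU, `E₁ = −0.8295699476`, margin `4.3e-4`)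
meets it OUTSIDE Lean; its re-emission as a `SymCert` (words + exact-ℚ `LᴴL` Gram factors, certc mode gram)
and a kernel `decide` (or a proved reflection of `symCheck`) would close this stub with NO claim node.
First rungs: any edition `> −1.0432` beats the tree's unconditional floor
`energyDensity2D_one_eight_sevenEighths_ge`; v0′-class (`|Λ'| = 6`) ≈ −1.00; CORE #294 −0.8605. -/
def SymCertData_m83o100 : Prop :=
  ∃ K : SymCert, symCheck K = true ∧ (-83 / 100 : ℚ) ≤ symValue K

theorem stub_symCertData_m83o100 : SymCertData_m83o100 := by
  sorry

/-- **S6 (= wardk W3 target; PROVED).**  Ward × `D₄` window certificates bound the thermodynamic-limit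
energy density.  Proved sorry-free as `DualReplay.wardD4WindowSound_holds`
(`Cruxes/LowerEdge_ge_m83o100/Lines/dualreplay.lean`, dual-plan-1; axioms `propext/Classical.choice/Quot.sound`);
Literature port in review (sym-eng-3: generic-sector torus theorem p609054 → W3 → W2).  Closes by `exact`
once either is importable; kept a stub here only for that reason. -/
theorem stub_wardWindowSound : WardD4WindowSound := by
  sorry

/-! ### Support stubs outside the composition chain (rev 3; hosted for the orbit-pair-table checker,
captain idea-1 g3 card `Ideas/orbit-pair-table-checker.md`, per crit-2 l.743 (ii)) -/

/-- **S7 (M; TRUE — OPTIONAL support, not consumed by `LowerEdge_ge_*_of` nor by the orbit-pair soundness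
(crit-2 l.757); kept as the algebraic statement for whoever wants canonical forms to be unique).**  Normal words are linearly independent:
a polynomial of pairwise distinct `nfWord`-fixed words supported in `Λ'` that evaluates to `0` in `𝔄_{Λ'}` has
all coefficients `0`.  (The `nfWord`-fixed words are, mode by mode in `Letter.blt` order, products of one of
`1, c†_m, c_m, c†_m c_m` — `4^{2|Λ'|}` words, a basis of the full matrix algebra on Fock space; Bratteli–Robinson
II §5.2.2, Tasaki 2020 §9.2 [cite: Tasaki2020].)  This is the uniqueness half of the normal form that S1
(existence/faithfulness) lacks; with it `collect ∘ nfPoly` is a canonical form. -/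
def NormalWordsIndependent : Prop :=
  ∀ (Λ' : Finset (Site 2)) (p : QPoly),
    (∀ t ∈ p, SuppIn t.2 Λ' ∧ nfWord t.2 = [(1, t.2)]) →
    p.Pairwise (fun s t => wordEq s.2 t.2 = false) →
    polyOp Λ' p = 0 → ∀ t ∈ p, t.1 = 0

theorem stub_normalWordsIndependent : NormalWordsIndependent := by
  sorry

/-- **S8 (M given S7 + the PROVED `moveOp_equivariant`; TRUE — OPTIONAL support, not consumed by `LowerEdge_ge_*_of`;
per crit-2 l.757 the orbit-pair table needs only the operator/value form `moveOp_equivariant`/`value_moveWord` above,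
which is sorry-free).**  Equivariance of the
normal-orderer under licensed affine-`D₄` moves, in the checker's own currency: normal-ordering commutes with
moving, up to re-collection — `nf (γ·w + v) ≡ re-sort (γ·nf(w) + v)`.  Site moves carry NO fermionic sign in
this letter convention (the sign lives entirely in the re-sorting that `nfPoly` performs); a signed `S_z`-flip
or particle–hole map is a different letter map and is NOT covered here.  Proof route: both sides have the same
`polyOp` on `frame.toFinset` (S1 faithfulness on each side, S2 = moves are restrictions of the `*`-homomorphism
`fermionEmbed ∘ PolySite.d4Emb`), hence their difference is a polynomial of normal words evaluating to `0`,
and S7 + exactness of the merge-sort `collect` give `isZero`.  This is the `hequiv` term crit-2 l.743 (ii)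
names as load-bearing for the orbit-pair table `T(a,k,b)`: every table relabelling is an instance. -/
def MoveEquivariant : Prop :=
  ∀ (inner frame : List (Site 2)) (γ : DihedralGroup 4) (v : Site 2) (w : Word),
    subSites inner frame = true → licensedMove inner frame γ v = true → suppIn w inner = true →
    isZero (psub (nfPoly (movePolyW γ v (nfWord w))) (nfWord (moveWord γ v w))) = true

theorem stub_moveEquivariant : MoveEquivariant := by
  sorry

/-- S8 at work on one instance (kernel): `w = c_{0↑} c†_{e₁↑}` (NOT normal: `nf w = −c†_{e₁↑} c_{0↑}`), moved by the
rotation `r 1` about the origin inside the `3 × 3` frame. -/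
example : isZero (psub (nfPoly (movePolyW (DihedralGroup.r 1) 0 (nfWord [ann 0 0, cre e1 0])))
    (nfWord (moveWord (DihedralGroup.r 1) 0 [ann 0 0, cre e1 0]))) = true := by
  decide +kernel

/-! ### Composition (no `sorry` below this line) -/

/-- S1–S4 + S6: every passing syntactic certificate bounds `e₀(t=1, t'=0, U=8, n=7/8)` from below by its value. -/
theorem energyDensity_ge_of_symCheck (h1 : NfFaithful) (h2 : MoveSound) (h3 : DictionarySound)
    (h4 : NfFaithful → MoveSound → DictionarySound → SymCheckSound) (h6 : WardD4WindowSound)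
    (K : SymCert) (hK : symCheck K = true) :
    ((symValue K : ℚ) : ℝ) ≤ energyDensityTT' 1 0 8 (7 / 8) :=
  energyDensity_ge_of_windowSound_cert _ h6 (h4 h1 h2 h3 K hK)

/-- The pipeline end to end on the kernel-checked toy certificate: S1–S4 + S6 ⊢ `−23/4 ≤ e₀`. -/
theorem toy_energy_ge (h1 : NfFaithful) (h2 : MoveSound) (h3 : DictionarySound)
    (h4 : NfFaithful → MoveSound → DictionarySound → SymCheckSound) (h6 : WardD4WindowSound) :
    ((((-23) / 4 : ℚ) : ℚ) : ℝ) ≤ energyDensityTT' 1 0 8 (7 / 8) := by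
  have h := energyDensity_ge_of_symCheck h1 h2 h3 h4 h6 toyCert toyCert_check
  rwa [toyCert_value] at h

/-- **The skeleton's composition: S1 → S2 → S3 → S4 → S5 → S6 → the crux BY NAME.** -/
theorem LowerEdge_ge_m83o100_of :
    NfFaithful → MoveSound → DictionarySound →
    (NfFaithful → MoveSound → DictionarySound → SymCheckSound) →
    SymCertData_m83o100 → WardD4WindowSound →
    Summit.Ventures.CertifiedManyBodySolver.Theses.M3x2EdgeSplit.LowerEdge_ge_m83o100 := by
  intro h1 h2 h3 h4 h5 h6
  obtain ⟨K, hK, hv⟩ := h5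
  show ∃ lo : ℚ, (-83 / 100 : ℚ) ≤ lo ∧ Summit.Ventures.CertifiedManyBodySolver.M3EnergyLowerRow 0 lo
  refine ⟨symValue K, hv, ?_⟩
  show (((symValue K : ℚ) : ℝ)) ≤ energyDensityTT' 1 0 8 (7 / 8)
  exact energyDensity_ge_of_symCheck h1 h2 h3 h4 h6 K hK

/-- The crux from the six stubs (sorries live only inside `stub_*`). -/
theorem lowerEdge_ge_m83o100_skeleton :
    Summit.Ventures.CertifiedManyBodySolver.Theses.M3x2EdgeSplit.LowerEdge_ge_m83o100 :=
  LowerEdge_ge_m83o100_of stub_nfFaithful stub_moveSound stub_dictionarySound stub_soundOfKernels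
    stub_symCertData_m83o100 stub_wardWindowSound

end

end Summit.Ventures.CertifiedManyBodySolver.Cruxes.LowerEdge_ge_m83o100.SymReplay
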